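import Literature.NumberTheory.LFunctions.HeilbronnPhenomenonElementary
import Literature.NumberTheory.LFunctions.DeuringPhenomenonElementaryProofs
import Literature.NumberTheory.LFunctions.DirichletConvOneChiSum
import Literature.NumberTheory.LFunctions.DirichletLDerivativeLogSqBound
import Literature.NumberTheory.LFunctions.DirichletLDerivativePartialSumBound
import Literature.NumberTheory.LFunctions.RealCharacterDivisorSums
import Literature.NumberTheory.LFunctions.RankinEisensteinFactorisation
import Mathlib.NumberTheory.ArithmeticFunction.Misc
import Mathlib.NumberTheory.ArithmeticFunction.Moebius
import HarnessLib

/-!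
# Pintz 1976 (IV), Theorem 1 — PROVED: the Heilbronn phenomenon with explicit constants
# (`L(1, χ_D) > 1/(140 U^{6γ} log³U)` from one zero `1 − γ + it`, `γ < 0.05`, of any `L(s, χ_k)`)

Topic `Literature/NumberTheory/LFunctions` (namespace `Literature.NumberTheory.LFunctions`, helpers in the
grouping sub-namespace `Pintz1976Heilbronn`). PROOF LAYER for the statement file
`HeilbronnPhenomenonElementary.lean` (cell `parity-realchar`, SIEGEL INSTRUMENT, conditionals column
topic I.8 «Deuring–Heilbronn repulsion, explicit», HEILBRONN half): the named fact

* `pintz1976Heilbronn_theorem1` — J. Pintz, *Elementary methods in the theory of L-functions, IV. The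
  Heilbronn phenomenon*, Acta Arith. **31** (1976) 419–429, Theorem 1 p. 422 (2.1): "Let us assume that an
  `L`-function belonging to a non-principal (real or complex) character `χ_k mod k` has an
  `s₀ = 1 − γ + it` zero with `γ < 0.05`. Then for an arbitrary real non-principal character `χ_D mod D`
  (for which `χ_kχ_D` is also non-principal) the inequality `L(1, χ_D) > 1/(140 U^{6γ} log³U)` holds,
  where `U = k|s₀|D`" (for `D > D₀`, an absolute effective constant, p. 422) —

is discharged here as `theorem pintz1976Heilbronn_theorem1_holds : pintz1976Heilbronn_theorem1`, and

* `pintz1976Heilbronn_theorem2` — ibid. Theorem 2 p. 423 (2.2): under the same hypotheses, a real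
  exceptional zero `1 − δ` of `L(s, χ_D)` has `δ > 1/(140 U^{6γ} log⁵U)` (§4: Theorem 1 and Page's
  `L(1)/δ ≤ log²D ≤ log²U`, (4.1)) —

as `theorem pintz1976Heilbronn_theorem2_holds : pintz1976Heilbronn_theorem2` (Part I).
Everything in this file is PROVED (theorems and auxiliary definitions of arithmetic functions only; no
named fact); axioms `propext`, `Classical.choice`, `Quot.sound`.

## Source and road (printed proof §3 pp. 424–426, READ from the journal scan
## `matwbn.icm.edu.pl/ksiazki/aa/aa31/aa31410.pdf`, rendered page by page, 2026-08-29)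

PRINT: "(3.1) `A_ν = {n; p∣n ⇒ χ_D(p) = ν}` (`ν = −1, 0, 1`), (3.2) `C = {c; c = ab, a ∈ A₁, b ∈ A₀}`
… (3.5) `g_λ(n) = Σ_{d∣n} λ(d) = 1` if `n = l²`, `0` if `n ≠ l²`, and (3.6)
`g_D(n) = Σ_{d∣n} χ_D(d) = ∏_{p^α∥n}(1 + χ(p) + … + χ^α(p)) ≥ 0` are multiplicative. …
(3.10) `g_λ(n) = Σ_{c∣n, c ∈ C, c = ab} 2^{ν(a)} λ(c) g_D(n/c)`. … (3.11) `2^{ν(a)} ≤ g_D(c) ≤ d(c)`.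
Thus (3.12) `0.11 ≤ 1 − Σ_{l=2}^∞ l^{−2(1−γ)} ≤ |Σ_{n ≤ U⁶, n = l²} χ_k(n) n^{−s₀}| =
|Σ_{c ≤ U⁶, c ∈ C} 2^{ν(a)}λ(c)χ_k(c) c^{−s₀} Σ_{r ≤ U⁶/c} χ_k(r) r^{−s₀} g_D(r)| ≤ Σ₁ + Σ₂`,
`Σ₁ = Σ_{n ≤ U³} d(n) n^{−(1−γ)} |Σ_{r ≤ U⁶/n} χ_k(r) r^{−s₀} g_D(r)|`,
`Σ₂ = Σ_{U³ < n ≤ U⁶} g_D(n) n^{−(1−γ)} Σ_{r ≤ U⁶/n} d(r) r^{−(1−γ)}`. Here as `L(s₀, χ_k) = 0`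
estimating the finite partial sums of `L(s₀, χ_kχ_D)` and `L(s₀, χ_k)` by partial summation for
`y ≥ U³` we get (3.13) `|Σ_{r≤y} χ_k(r) r^{−s₀} Σ_{d∣r} χ_D(d)| ≤ Σ_{d ≤ √y} d^{−(1−γ)}·2k|s₀|/(y/d)^{1−γ} +
Σ_{l ≤ √y} l^{−(1−γ)}·2kD|s₀|/(√y)^{1−γ} < 1/(100 y^γ log²y)`. (3.14) `Σ₁ < (1/(100 log²U³)) Σ_{n≤U³} d(n)/n
< 1/100`, (3.15) `Σ₂ > 1/10`. On the other hand using Lemma 1 of [part II] with the values `x₁ = U³`,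
`x₂ = U⁶` … (3.16) `Σ_{U³ ≤ n ≤ U⁶} g_D(n)/n = 3 log U (L(1, χ_D) + O(U^{−5/4}))`. This implies (3.17)
`1/10 < Σ₂ < U^{6γ} Σ_{U³<n≤U⁶} g_D(n)/n Σ_{r ≤ U⁶/n} d(r)/r < U^{6γ} 3 log U (L(1,χ_D) + O(U^{−5/4}))
(½ + o(1)) log²U³ < (13.5 + o(1)) log³U·L(1, χ_D) U^{6γ} + o(1)`, which proves Theorem 1." ∎

HERE, in the same order, with the tree's engines (`V = ⌊U⌋`, `N₁ = V³`, `N = V⁶` natural):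

* **Part A — (3.5), (3.10), (3.11)**: `f := λ ∗ (μ·χ_D)` (Pintz's weight `2^{ν(a)}λ(c)` on `C`, `0` off
  `C`: `weight_prime_pow`), `g_D ∗ f = 1_□` as `(1∗χ)∗(λ∗μχ) = (1∗λ)∗(χ∗μχ)`
  (`charDivisorSum_mul_weight`, via Mathlib's `IsMultiplicative.eq_iff_eq_on_prime_powers`), and
  `|f| ≤ g_D ≤ d` (`abs_weight_le_charDivisorSum`); `g_D = RealChar.charDivisorSum` of the tree.
* **Part B — the swap in (3.12)** (`sum_sqInd_eq_sum_weight_mul_innerSum`, generic hyperbola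
  identities from Mathlib's `ArithmeticFunction.sum_Ioc_mul_eq_sum_sum`) and the reindexing over squares.
* **Part C — the lower bound of (3.12)** (`norm_sum_sq_ge`): `1 − Σ_{l≥2} l^{−2σ} ≥ 1 − (2^{−2σ} +
  2^{1−2σ}/(2σ−1)) ≥ 0.134` for `σ > 0.95` (integral comparison; `2^{0.9} ≥ 1.863`).
* **Part D — (3.13)** (`norm_innerSum_le`): hyperbola at `z = ⌊√M⌋`, the tails of `L(s₀, χ_k)` and the
  blocks of `χ_kχ_D` (a character mod `kD`, `prodChar`) by the part-III engines
  `Pintz1976Deuring.norm_sum_char_cpow_sub_LFunction_le` / `norm_sum_Ioc_char_cpow_le` with the TRIVIAL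
  partial-sum bounds `k`, `kD` (`DirichletAbel.norm_partialSum_le`), giving
  `‖S(M)‖ ≤ 4kD(1 + |s₀|/σ)(2 + log M) M^{1/2−σ}` for all `M ≥ 1` (Pintz's `< 1/(100 y^γ log²y)` for
  `y ≥ U³` is this bound evaluated).
* **Part E — `Σ_{m ≤ M} d(m)/m ≤ ½ log²M + 2 log M + 2`** (`sum_card_divisors_div_le`; Pintz's
  `(½ + o(1)) log²` and `Σ d(n)/n < log²`), by `Σ log a/a ≥ ½log²M − 1` (Mathlib's
  `Real.log_div_self_antitoneOn` + `AntitoneOn.integral_le_sum_Ico`).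
* **Part F — (3.16)** (`sum_charDivisorSum_div_le`): the tree's Montgomery–Vaughan Exercise 11.2.3(g)
  `DirichletAbel.norm_sum_divisorSum_div_sub_le` (in place of Lemma 1 of part II), differenced between
  `V³` and `V⁶`: `Σ_{V³<c≤V⁶} g_D(c)/c ≤ 3 log V · L(1, χ_D) + 300 log V/V` (`D ≤ 3V`).
* **Part G — (3.14), (3.17)** (`sigma_one_le`, `sigma_two_le`) and **Part H — assembly**
  (`main_inequality`: `0.134 ≤ 1200 log³V·V^{−1/5} + V^{6γ}(4.5 log²V + 6 log V + 2)(3 log V·L(1,χ_D) +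
  300 log V/V)`; `eventually_thresholds`; `endgame`): for `V ≥ V₀` this gives
  `L(1, χ_D) ≥ 0.0086/(V^{6γ} log³V) > 1/(140 U^{6γ} log³U)` (`V ≤ U`), i.e. the printed `1/140` with room
  (the print's own constant is `1/(135 + o(1))`); `D₀ = 2V₀ + 10` (`U ≥ 0.95 D`). The quantitative
  core is `theorem1_core` (`L(1, χ_D) ≥ 0.0086/(V^{6γ} log³V)`, via `endgame_strong`).
* **Part I — Theorem 2, §4 (4.1)**: PRINT "Theorem 2 follows from Theorem 1, if we recall that for the
  greatest real zero `1 − δ` of `L(s, χ_D)` (where `χ_D` is a real non-principal character mod `D`), by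
  the arguments of Page [24] (4.1) `L(1)/δ ≤ log²D ≤ log²U`." HERE, for EVERY real zero `1 − δ` of an
  arbitrary non-principal `χ_D` mod `D` with `log D ≥ 100`: `‖L(1, χ_D)‖ ≤ 0.7 δ log²D`
  (`norm_LFunction_one_le_of_realZero`) — for `δ ≤ 1.6/log D` by the mean value theorem with
  `‖L'(σ, χ_D)‖ ≤ 0.55 log²D` on `[1 − 1.6/log D, 1]` (`norm_deriv_LFunction_le_near_one_large`, the
  tree's generic bound `DirichletAbel.norm_deriv_LFunction_le_near_one_of_partialSum_le` at
  Pólya–Vinogradov strength `9√D log D`, valid for imprimitive `χ_D`), otherwise from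
  `‖L(1, χ_D)‖ ≤ log D + 3`; then `δ ≥ 0.0086/(0.7014 U^{6γ} log⁵U) > 1/(140 U^{6γ} log⁵U)`
  (`log D ≤ log U + 0.053` as `U ≥ 0.95D`); `D₀ = 2V₀ + 10 + ⌈e^{100}⌉`.

## References

* [Pintz1976ElementaryIV] J. Pintz, Acta Arith. 31 (1976) 419–429: Theorem 1 p. 422 (2.1); proof §3
  pp. 424–426, (3.1)–(3.17); Theorem 2 p. 423 (2.2), proof §4 (4.1) p. 426; standing assumption
  "`D > D₀`" p. 422.
* [MontgomeryVaughan2007] H. L. Montgomery, R. C. Vaughan, *Multiplicative Number Theory I*, CUP 2007: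
  §1.3 (Abel summation), §4.3 (4.23) (`|Σχ| ≤ q`), §11.2.1 Exercise 3(g).
* [DavenportMNT1980] H. Davenport, *Multiplicative Number Theory*, Ch. 6 (`r = 1 ∗ χ ≥ 0`).
-/

noncomputable section

open Complex Finset ArithmeticFunction
open scoped ArithmeticFunction.zeta ArithmeticFunction.Moebius ArithmeticFunction.Omega

namespace Literature.NumberTheory.LFunctions

namespace Pintz1976Heilbronn

open DirichletAbel RealChar

variable {q : ℕ} (χ : DirichletCharacter ℂ q)

/-! ### Part A — the arithmetic identity (3.10): `1_□ = g_D ∗ f` -/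

/-- Liouville's function `λ(n) = (−1)^{Ω(n)}` as a real arithmetic function. [folklore] -/
def liouville : ArithmeticFunction ℝ :=
  ⟨fun n => if n = 0 then 0 else (-1) ^ (Ω n), if_pos rfl⟩

/-- `λ(n) = (−1)^{Ω(n)}` for `n ≠ 0`. [cite: Pintz1976ElementaryIV, §3 (3.5) p. 424] -/
theorem liouville_apply {n : ℕ} (hn : n ≠ 0) : liouville n = (-1) ^ (Ω n) := if_neg hn

/-- `λ` is multiplicative (indeed completely multiplicative). [cite: Pintz1976ElementaryIV, §3 (3.5) p. 424] -/
theorem isMultiplicative_liouville : IsMultiplicative liouville := by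
  rw [IsMultiplicative.iff_ne_zero]
  refine ⟨by rw [liouville_apply one_ne_zero]; simp, fun {m n} hm hn _ => ?_⟩
  rw [liouville_apply (mul_ne_zero hm hn), liouville_apply hm, liouville_apply hn,
    cardFactors_mul hm hn, pow_add]

/-- `λ(p^k) = (−1)^k`. [cite: Pintz1976ElementaryIV, §3 (3.5) p. 424] -/
theorem liouville_prime_pow {p : ℕ} (hp : p.Prime) (k : ℕ) : liouville (p ^ k) = (-1) ^ k := by
  rw [liouville_apply (pow_ne_zero k hp.ne_zero), cardFactors_apply_prime_pow hp]

/-- `|λ(n)| ≤ 1`. [cite: Pintz1976ElementaryIV, §3 (3.5) p. 424] -/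
theorem abs_liouville_le (n : ℕ) : |liouville n| ≤ 1 := by
  rcases eq_or_ne n 0 with rfl | hn
  · simp [liouville]
  rw [liouville_apply hn, abs_pow, abs_neg, abs_one, one_pow]

/-- `μ·χ` (pointwise), a real arithmetic function. [folklore] -/
def muChi : ArithmeticFunction ℝ := (μ : ArithmeticFunction ℝ).pmul (reChar χ)

/-- `(μ·χ)(n) = μ(n) χ(n)`. [cite: Pintz1976ElementaryIV, §3 (3.7)–(3.10) pp. 424–425] -/
theorem muChi_apply (n : ℕ) : muChi χ n = (μ n : ℝ) * reChar χ n := by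
  rw [muChi, pmul_apply, intCoe_apply]

/-- `μ·χ` is multiplicative (quadratic `χ`). [cite: Pintz1976ElementaryIV, §3 (3.7)–(3.10) pp. 424–425] -/
theorem isMultiplicative_muChi (hq : χ ^ 2 = 1) : IsMultiplicative (muChi χ) :=
  isMultiplicative_moebius.intCast.pmul (isMultiplicative_reChar χ hq)

/-- `|(μ·χ)(n)| ≤ 1`. [cite: Pintz1976ElementaryIV, §3 (3.7)–(3.10) pp. 424–425] -/
theorem abs_muChi_le (n : ℕ) : |muChi χ n| ≤ 1 := by
  rw [muChi_apply, abs_mul]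
  have h1 : |(μ n : ℝ)| ≤ 1 := by exact_mod_cast abs_moebius_le_one
  exact mul_le_one₀ h1 (abs_nonneg _) (abs_reChar_le_one χ n)

/-- Pintz's weight `f = λ ∗ (μ·χ)`: the multiplicative function with `f(p^a) = (−1)^a (1 + χ(p))`
(`a ≥ 1`), i.e. `2^{ν(a)}λ(c)` on `C = {ab : a ∈ A₁, b ∈ A₀}` and `0` elsewhere.
[cite: Pintz1976ElementaryIV, §3 (3.7)–(3.10) p. 424–425] -/
def weight : ArithmeticFunction ℝ := liouville * muChi χ

/-- `f` is multiplicative. [cite: Pintz1976ElementaryIV, §3 (3.7)–(3.10) pp. 424–425] -/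
theorem isMultiplicative_weight (hq : χ ^ 2 = 1) : IsMultiplicative (weight χ) :=
  isMultiplicative_liouville.mul (isMultiplicative_muChi χ hq)

/-- A sum over the divisors of `p^(b+1)` indexed as `range (b+2)`, with all terms beyond the first
two vanishing. [folklore] -/
private theorem sum_range_add_two_eq {F : ℕ → ℝ} {b : ℕ} (h : ∀ i, F (i + 2) = 0) :
    ∑ i ∈ range (b + 2), F i = F 0 + F 1 := by
  rw [sum_range_succ', sum_range_succ']
  have h' : ∀ x, F (x + 1 + 1) = 0 := fun x => h x
  simp only [h', sum_const_zero, zero_add]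
  exact add_comm _ _

/-- `μ(p^(i+2)) = 0`. [folklore] -/
private theorem moebius_prime_pow_add_two {p : ℕ} (hp : p.Prime) (i : ℕ) :
    (μ (p ^ (i + 2)) : ℝ) = 0 := by
  rw [moebius_apply_prime_pow hp (by omega : i + 2 ≠ 0), if_neg (by omega)]
  simp

/-- **`χ ∗ (μ·χ) = ε`** (the Dirichlet inverse of a completely multiplicative function; quadratic `χ`).
[cite: Pintz1976ElementaryIV, §3 (3.10) p. 425] -/
theorem reChar_mul_muChi (hq : χ ^ 2 = 1) : reChar χ * muChi χ = 1 := by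
  rw [IsMultiplicative.eq_iff_eq_on_prime_powers _
    ((isMultiplicative_reChar χ hq).mul (isMultiplicative_muChi χ hq)) _ isMultiplicative_one]
  intro p a hp
  rcases Nat.eq_zero_or_pos a with rfl | ha
  · rw [pow_zero, ((isMultiplicative_reChar χ hq).mul (isMultiplicative_muChi χ hq)).map_one,
      isMultiplicative_one.map_one]
  obtain ⟨b, rfl⟩ : ∃ b, a = b + 1 := ⟨a - 1, by omega⟩
  rw [one_apply_ne (by
      have := Nat.one_lt_pow (by omega : b + 1 ≠ 0) hp.one_lt
      omega), mul_apply, Nat.sum_divisorsAntidiagonal' (fun x y => reChar χ x * muChi χ y),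
    Nat.divisors_prime_pow hp, Finset.sum_map]
  simp only [Function.Embedding.coeFn_mk]
  have hdiv : p ^ (b + 1) / p = p ^ b := by rw [pow_succ, Nat.mul_div_cancel _ hp.pos]
  rw [sum_range_add_two_eq]
  · simp only [pow_zero, Nat.div_one, muChi_apply, pow_one, hdiv, moebius_apply_prime hp,
      isMultiplicative_moebius.map_one, reChar_one, reChar_pow χ hq hp.ne_zero]
    push_cast
    ring
  · intro i
    rw [muChi_apply, moebius_prime_pow_add_two hp]
    ring

/-- **`f(p^a) = (−1)^a (1 + χ(p))`** for `a ≥ 1`. [cite: Pintz1976ElementaryIV, §3 (3.7) p. 424] -/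
theorem weight_prime_pow {p : ℕ} (hp : p.Prime) {a : ℕ} (ha : a ≠ 0) :
    weight χ (p ^ a) = (-1) ^ a * (1 + reChar χ p) := by
  obtain ⟨b, rfl⟩ : ∃ b, a = b + 1 := ⟨a - 1, by omega⟩
  rw [weight, mul_apply, Nat.sum_divisorsAntidiagonal' (fun x y => liouville x * muChi χ y),
    Nat.divisors_prime_pow hp, Finset.sum_map]
  simp only [Function.Embedding.coeFn_mk]
  have hdiv : p ^ (b + 1) / p = p ^ b := by rw [pow_succ, Nat.mul_div_cancel _ hp.pos]
  rw [sum_range_add_two_eq]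
  · simp only [pow_zero, Nat.div_one, muChi_apply, pow_one, hdiv, moebius_apply_prime hp,
      isMultiplicative_moebius.map_one, reChar_one, liouville_prime_pow hp]
    push_cast
    ring
  · intro i
    rw [muChi_apply, moebius_prime_pow_add_two hp]
    ring

/-- `|f(p^a)| = 1 + χ(p)` for `a ≥ 1` (quadratic `χ`: `1 + χ(p) ∈ {0, 1, 2}`). [cite: Pintz1976ElementaryIV, §3 (3.11) p. 425] -/
theorem abs_weight_prime_pow (hq : χ ^ 2 = 1) {p : ℕ} (hp : p.Prime) {a : ℕ} (ha : a ≠ 0) :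
    |weight χ (p ^ a)| = 1 + reChar χ p := by
  rw [weight_prime_pow χ hp ha, abs_mul, abs_pow, abs_neg, abs_one, one_pow, one_mul]
  have h : 0 ≤ 1 + reChar χ p := by
    rcases reChar_trichotomy χ hq p with h | h | h <;> rw [h] <;> norm_num
  exact abs_of_nonneg h

/-- `1 + χ(p) ≤ r(p^a)` for `a ≥ 1` (`r = 1 ∗ χ`; split `2 ≤ a+1`, ramified `1 ≤ 1`, inert
`0 ≤ [a even]`). [cite: Pintz1976ElementaryIV, §3 (3.11) p. 425] -/
theorem one_add_reChar_le_charDivisorSum_prime_pow (hq : χ ^ 2 = 1) {p : ℕ} (hp : p.Prime)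
    {a : ℕ} (ha : a ≠ 0) : 1 + reChar χ p ≤ charDivisorSum χ (p ^ a) := by
  rw [charDivisorSum_prime_pow χ hq hp]
  rcases reChar_trichotomy χ hq p with h | h | h <;> rw [h]
  · rw [zero_geom_sum, if_neg (by omega)]; norm_num
  · simp only [one_pow, sum_const, card_range, nsmul_eq_mul, mul_one]
    have : (2 : ℝ) ≤ ((a + 1 : ℕ) : ℝ) := by exact_mod_cast (by omega : 2 ≤ a + 1)
    push_cast at this ⊢
    linarith
  · rw [neg_one_geom_sum]
    split_ifs <;> norm_num

/-- **`|f(n)| ≤ r(n)`** for every `n` (quadratic `χ`; (3.11): `2^{ν(a)} ≤ g_D(c)` on `C`, and `f = 0`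
off `C`). [cite: Pintz1976ElementaryIV, §3 (3.11) p. 425] -/
theorem abs_weight_le_charDivisorSum (hq : χ ^ 2 = 1) (n : ℕ) :
    |weight χ n| ≤ charDivisorSum χ n := by
  rcases eq_or_ne n 0 with rfl | hn
  · simp
  rw [(isMultiplicative_weight χ hq).multiplicative_factorization _ hn,
    (isMultiplicative_charDivisorSum χ hq).multiplicative_factorization _ hn, Finsupp.prod,
    Finsupp.prod, Finset.abs_prod]
  refine Finset.prod_le_prod (fun p _ => abs_nonneg _) fun p hp => ?_
  have hpp : p.Prime := Nat.prime_of_mem_primeFactors (Nat.support_factorization n ▸ hp)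
  have hk : n.factorization p ≠ 0 := Finsupp.mem_support_iff.mp hp
  rw [abs_weight_prime_pow χ hq hpp hk]
  exact one_add_reChar_le_charDivisorSum_prime_pow χ hq hpp hk

/-- `|f(n)| ≤ τ(n)`. [cite: Pintz1976ElementaryIV, §3 (3.11) p. 425] -/
theorem abs_weight_le_card_divisors (hq : χ ^ 2 = 1) (n : ℕ) :
    |weight χ n| ≤ (n.divisors.card : ℝ) :=
  (abs_weight_le_charDivisorSum χ hq n).trans
    ((le_abs_self _).trans (abs_charDivisorSum_le χ n))

/-! #### The indicator of the squares -/

/-- The indicator of the positive perfect squares, as a real arithmetic function. [folklore] -/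
def sqInd : ArithmeticFunction ℝ :=
  ⟨fun n => if n ≠ 0 ∧ IsSquare n then 1 else 0, by simp⟩

/-- Evaluation of `sqInd`. [cite: Pintz1976ElementaryIV, §3 (3.5) p. 424] -/
theorem sqInd_apply (n : ℕ) : sqInd n = if n ≠ 0 ∧ IsSquare n then 1 else 0 := rfl

/-- `sqInd` is multiplicative. [cite: Pintz1976ElementaryIV, §3 (3.5) p. 424] -/
theorem isMultiplicative_sqInd : IsMultiplicative sqInd := by
  rw [IsMultiplicative.iff_ne_zero]
  refine ⟨by simp [sqInd_apply], fun {m n} hm hn hmn => ?_⟩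
  simp only [sqInd_apply, ne_eq, mul_eq_zero, hm, hn, or_self, not_false_eq_true, true_and,
    RankinEisenstein.isSquare_mul_iff_of_coprime hmn]
  by_cases h1 : IsSquare m <;> by_cases h2 : IsSquare n <;> simp [h1, h2]

/-- `sqInd(p^a) = [a even]`. [cite: Pintz1976ElementaryIV, §3 (3.5) p. 424] -/
theorem sqInd_prime_pow {p : ℕ} (hp : p.Prime) (a : ℕ) :
    sqInd (p ^ a) = if Even a then 1 else 0 := by
  rw [sqInd_apply]
  simp [hp.ne_zero, RankinEisenstein.isSquare_prime_pow_iff hp]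

/-- **`ζ ∗ λ = 1_□`**: `Σ_{d ∣ n} λ(d) = [n is a square]` ((3.5)). [cite: Pintz1976ElementaryIV, §3 (3.5) p. 424] -/
theorem zeta_mul_liouville : (ζ : ArithmeticFunction ℝ) * liouville = sqInd := by
  rw [IsMultiplicative.eq_iff_eq_on_prime_powers _
    (isMultiplicative_zeta.natCast.mul isMultiplicative_liouville) _ isMultiplicative_sqInd]
  intro p a hp
  rw [coe_zeta_mul_apply, Nat.divisors_prime_pow hp, Finset.sum_map, sqInd_prime_pow hp]
  simp only [Function.Embedding.coeFn_mk, liouville_prime_pow hp]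
  rw [neg_one_geom_sum]
  by_cases h : Even a
  · rw [if_pos h, if_neg (by simpa [Nat.even_add_one] using h)]
  · rw [if_neg h, if_pos (by simpa [Nat.even_add_one] using h)]

/-- **(3.10): `g_D ∗ f = 1_□`** — `Σ_{c ∣ n} f(c) g_D(n/c) = [n = l²]` for quadratic `χ = χ_D`
(`g_D = r = 1 ∗ χ`): `(1∗χ)∗(λ∗μχ) = (1∗λ)∗(χ∗μχ) = 1_□ ∗ ε`. [cite: Pintz1976ElementaryIV, §3 (3.10) p. 425] -/
theorem charDivisorSum_mul_weight (hq : χ ^ 2 = 1) : charDivisorSum χ * weight χ = sqInd := by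
  rw [charDivisorSum, weight,
    show reChar χ * (ζ : ArithmeticFunction ℝ) * (liouville * muChi χ) =
      ((ζ : ArithmeticFunction ℝ) * liouville) * (reChar χ * muChi χ) by ring,
    zeta_mul_liouville, reChar_mul_muChi χ hq, mul_one]

/-! ### Part B — hyperbola identities and the reduction (3.12) -/

/-- **Dirichlet's hyperbola identity** (generic): `Σ_{n ≤ N} Σ_{d ∣ n} a(d) b(n/d) =
Σ_{d ≤ N} a(d) Σ_{m ≤ N/d} b(m)`. [cite: Pintz1976ElementaryIV, §3 (3.12)–(3.13) p. 425] -/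
theorem sum_Ioc_sum_divisors_eq {R : Type*} [CommSemiring R] (a b : ℕ → R) (N : ℕ) :
    ∑ n ∈ Ioc 0 N, ∑ d ∈ n.divisors, a d * b (n / d) =
      ∑ d ∈ Ioc 0 N, a d * ∑ m ∈ Ioc 0 (N / d), b m := by
  set F : ArithmeticFunction R := ⟨fun d => if d = 0 then 0 else a d, if_pos rfl⟩ with hF
  set G : ArithmeticFunction R := ⟨fun m => if m = 0 then 0 else b m, if_pos rfl⟩ with hG
  have hFapp : ∀ {d : ℕ}, d ≠ 0 → F d = a d := fun {d} hd => if_neg hd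
  have hGapp : ∀ {m : ℕ}, m ≠ 0 → G m = b m := fun {m} hm => if_neg hm
  have hFG : ∀ n : ℕ, (F * G) n = ∑ d ∈ n.divisors, a d * b (n / d) := by
    intro n
    rcases eq_or_ne n 0 with rfl | hn
    · simp
    rw [mul_apply, ← Nat.map_div_right_divisors, Finset.sum_map]
    refine sum_congr rfl fun d hd => ?_
    have hdn : d ∣ n := Nat.dvd_of_mem_divisors hd
    have hd0 : d ≠ 0 := ne_zero_of_dvd_ne_zero hn hdn
    have hnd0 : n / d ≠ 0 := (Nat.div_ne_zero_iff_of_dvd hdn).mpr ⟨hn, hd0⟩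
    simp only [Function.Embedding.coeFn_mk, hFapp hd0, hGapp hnd0]
  have h := sum_Ioc_mul_eq_sum_sum F G N
  simp_rw [hFG] at h
  rw [h]
  refine sum_congr rfl fun d hd => ?_
  rw [hFapp (mem_Ioc.mp hd).1.ne']
  congr 1
  exact sum_congr rfl fun m hm => hGapp (mem_Ioc.mp hm).1.ne'

/-- A sum over `0 < a ≤ M` of a function vanishing for `a ≤ y` is a sum over `y < a ≤ M`. [folklore] -/
private theorem sum_Ioc_ite_lt (f : ℕ → ℂ) (y M : ℕ) :
    ∑ a ∈ Ioc 0 M, (if y < a then f a else 0) = ∑ a ∈ Ioc y M, f a := by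
  rw [← sum_filter]
  congr 1
  ext a
  simp only [mem_filter, mem_Ioc]
  omega

/-- **The hyperbola swap** (generic): `Σ_{y < d ≤ N} a(d) Σ_{m ≤ N/d} b(m) =
Σ_{m ≤ N} b(m) Σ_{y < d ≤ N/m} a(d)` (both count `a(d)b(m)` over `dm ≤ N`, `d > y`). [cite: Pintz1976ElementaryIV, §3 (3.13) p. 425] -/
theorem sum_Ioc_above_mul_sum_eq (a b : ℕ → ℂ) (y N : ℕ) :
    ∑ d ∈ Ioc y N, a d * ∑ m ∈ Ioc 0 (N / d), b m =
      ∑ m ∈ Ioc 0 N, b m * ∑ d ∈ Ioc y (N / m), a d := by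
  set F : ArithmeticFunction ℂ := ⟨fun d => if y < d then a d else 0, by simp⟩ with hF
  set G : ArithmeticFunction ℂ := ⟨fun m => if m = 0 then 0 else b m, if_pos rfl⟩ with hG
  have hFapp : ∀ d : ℕ, F d = if y < d then a d else 0 := fun d => rfl
  have hGapp : ∀ {m : ℕ}, m ≠ 0 → G m = b m := fun {m} hm => if_neg hm
  have h1 := sum_Ioc_mul_eq_sum_sum F G N
  have h2 := sum_Ioc_mul_eq_sum_sum G F N
  rw [mul_comm, h1] at h2
  have e1 : ∑ d ∈ Ioc 0 N, F d * ∑ m ∈ Ioc 0 (N / d), G m =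
      ∑ d ∈ Ioc y N, a d * ∑ m ∈ Ioc 0 (N / d), b m := by
    rw [← sum_Ioc_ite_lt (fun d => a d * ∑ m ∈ Ioc 0 (N / d), b m) y N]
    refine sum_congr rfl fun d hd => ?_
    rw [hFapp]
    split_ifs with h
    · congr 1
      exact sum_congr rfl fun m hm => hGapp (mem_Ioc.mp hm).1.ne'
    · rw [zero_mul]
  have e2 : ∑ m ∈ Ioc 0 N, G m * ∑ d ∈ Ioc 0 (N / m), F d =
      ∑ m ∈ Ioc 0 N, b m * ∑ d ∈ Ioc y (N / m), a d := by
    refine sum_congr rfl fun m hm => ?_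
    rw [hGapp (mem_Ioc.mp hm).1.ne']
    congr 1
    simp_rw [hFapp]
    exact sum_Ioc_ite_lt _ y (N / m)
  rw [← e1, h2, e2]

/-- `(r(n) : ℂ) = Σ_{d ∣ n} χ(d)` for quadratic `χ` (`r = charDivisorSum χ`). [cite: Pintz1976ElementaryIV, §3 (3.6) p. 424] -/
theorem ofReal_charDivisorSum_eq_sum (hq : χ ^ 2 = 1) (n : ℕ) :
    ((charDivisorSum χ n : ℝ) : ℂ) = ∑ d ∈ n.divisors, χ d := by
  rw [charDivisorSum_apply, ofReal_sum]
  refine sum_congr rfl fun d hd => ?_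
  exact ofReal_reChar χ hq (Nat.pos_of_mem_divisors hd).ne'

variable {k : ℕ} (χk : DirichletCharacter ℂ k)

/-- The inner sums of (3.12): `S(M) = Σ_{m ≤ M} χ_k(m) m^{-s} g_D(m)`.
[cite: Pintz1976ElementaryIV, §3 (3.12) p. 425] -/
def innerSum (s : ℂ) (M : ℕ) : ℂ :=
  ∑ m ∈ Ioc 0 M, χk m * (m : ℂ) ^ (-s) * (charDivisorSum χ m : ℝ)

/-- **(3.12), the swap**: `Σ_{n ≤ N} χ_k(n) n^{-s} 1_□(n) = Σ_{c ≤ N} f(c) χ_k(c) c^{-s} S(N/c)`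
(from `1_□ = g_D ∗ f`). [cite: Pintz1976ElementaryIV, §3 (3.12) p. 425] -/
theorem sum_sqInd_eq_sum_weight_mul_innerSum (hq : χ ^ 2 = 1) (s : ℂ) (N : ℕ) :
    ∑ n ∈ Ioc 0 N, χk n * (n : ℂ) ^ (-s) * (sqInd n : ℝ) =
      ∑ c ∈ Ioc 0 N, (weight χ c : ℝ) * χk c * (c : ℂ) ^ (-s) * innerSum χ χk s (N / c) := by
  have h := sum_Ioc_sum_divisors_eq (fun c => (weight χ c : ℝ) * χk c * (c : ℂ) ^ (-s))
    (fun m => χk m * (m : ℂ) ^ (-s) * (charDivisorSum χ m : ℝ)) N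
  simp only [innerSum]
  rw [← h]
  refine sum_congr rfl fun n hn => ?_
  have hn0 : n ≠ 0 := (mem_Ioc.mp hn).1.ne'
  rw [← charDivisorSum_mul_weight χ hq, mul_comm (charDivisorSum χ) (weight χ), mul_apply,
    Nat.sum_divisorsAntidiagonal (fun x y => weight χ x * charDivisorSum χ y), ofReal_sum,
    mul_sum]
  refine sum_congr rfl fun d hd => ?_
  have hdn : d ∣ n := Nat.dvd_of_mem_divisors hd
  obtain ⟨e, rfl⟩ := hdn
  have hd0 : d ≠ 0 := left_ne_zero_of_mul hn0
  have he0 : e ≠ 0 := right_ne_zero_of_mul hn0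
  have hc : ((d * e : ℕ) : ℂ) ^ (-s) = (d : ℂ) ^ (-s) * (e : ℂ) ^ (-s) := by
    rw [Nat.cast_mul]; exact natCast_mul_natCast_cpow d e (-s)
  have hχ : χk ((d * e : ℕ) : ZMod k) = χk d * χk e := by rw [Nat.cast_mul, map_mul]
  rw [Nat.mul_div_cancel_left e (Nat.pos_of_ne_zero hd0), hχ, hc, ofReal_mul]
  ring

/-- **Squares reindexed**: `Σ_{n ≤ M²} a(n) 1_□(n) = Σ_{l ≤ M} a(l²)`. [cite: Pintz1976ElementaryIV, §3 (3.12) p. 425] -/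
theorem sum_sqInd_eq_sum_sq (a : ℕ → ℂ) (M : ℕ) :
    ∑ n ∈ Ioc 0 (M ^ 2), a n * (sqInd n : ℝ) = ∑ l ∈ Ioc 0 M, a (l ^ 2) := by
  have hterm : ∀ n ∈ Ioc 0 (M ^ 2), a n * (sqInd n : ℝ) = if IsSquare n then a n else 0 := by
    intro n hn
    have hn0 : n ≠ 0 := (mem_Ioc.mp hn).1.ne'
    rw [sqInd_apply]
    by_cases h : IsSquare n
    · rw [if_pos ⟨hn0, h⟩, if_pos h, ofReal_one, mul_one]
    · rw [if_neg (fun h' => h h'.2), if_neg h, ofReal_zero, mul_zero]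
  rw [sum_congr rfl hterm, ← sum_filter]
  have himage : (Ioc 0 (M ^ 2)).filter IsSquare = (Ioc 0 M).image fun l => l ^ 2 := by
    ext n
    simp only [mem_filter, mem_Ioc, mem_image]
    constructor
    · rintro ⟨⟨hn0, hnM⟩, r, rfl⟩
      refine ⟨r, ⟨Nat.pos_of_ne_zero ?_, ?_⟩, by rw [sq]⟩
      · rintro rfl; simp at hn0
      · by_contra hcon
        push Not at hcon
        have : M ^ 2 < r * r := by rw [sq]; exact Nat.mul_self_lt_mul_self hcon
        omega
    · rintro ⟨l, ⟨hl0, hlM⟩, rfl⟩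
      refine ⟨⟨by positivity, Nat.pow_le_pow_left hlM 2⟩, ⟨l, by rw [sq]⟩⟩
  rw [himage, sum_image]
  intro x _ y _ hxy
  exact Nat.pow_left_injective two_ne_zero hxy

/-! ### Part C — the lower bound (3.12): `|Σ_{l ≤ M} χ_k(l²) l^{-2s}| ≥ 0.134` -/

/-- `2^{-9/10} ≤ 0.537` (since `0.537^{-10} ≤ 2^9`). [cite: Pintz1976ElementaryIV, §3 (3.12) p. 425 (the constant 0.11)] -/
theorem two_rpow_neg_nine_tenths_le : (2 : ℝ) ^ (-(9 / 10 : ℝ)) ≤ 0.537 := by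
  have h1 : (1.863 : ℝ) ≤ (2 : ℝ) ^ ((9 / 10 : ℝ)) := by
    have hpow : (1.863 : ℝ) ^ (10 : ℕ) ≤ (2 : ℝ) ^ (9 : ℕ) := by norm_num
    have ha : (0 : ℝ) ≤ 1.863 := by norm_num
    have h2 : ((1.863 : ℝ) ^ (10 : ℕ)) ^ ((10 : ℕ) : ℝ)⁻¹ ≤ ((2 : ℝ) ^ (9 : ℕ)) ^ ((10 : ℕ) : ℝ)⁻¹ :=
      Real.rpow_le_rpow (by positivity) hpow (by positivity)
    rw [Real.pow_rpow_inv_natCast ha (by norm_num)] at h2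
    refine h2.trans_eq ?_
    rw [← Real.rpow_natCast, ← Real.rpow_mul (by norm_num)]
    norm_num
  have h2 : (2 : ℝ) ^ (-(9 / 10 : ℝ)) = ((2 : ℝ) ^ ((9 / 10 : ℝ)))⁻¹ := Real.rpow_neg (by norm_num) _
  rw [h2]
  calc ((2 : ℝ) ^ ((9 / 10 : ℝ)))⁻¹ ≤ (1.863 : ℝ)⁻¹ := by
        gcongr
    _ ≤ 0.537 := by norm_num

/-- `Σ_{3 ≤ l ≤ M} l^{-2σ} ≤ 2^{1-2σ}/(2σ − 1)` for `σ > 1/2` (integral comparison). [cite: Pintz1976ElementaryIV, §3 (3.12) p. 425] -/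
theorem sum_Icc_three_rpow_le {σ : ℝ} (hσ : 1 / 2 < σ) (M : ℕ) :
    ∑ l ∈ Icc 3 M, (l : ℝ) ^ (-(2 * σ)) ≤ (2 : ℝ) ^ (1 - 2 * σ) / (2 * σ - 1) := by
  rcases lt_or_ge M 3 with hM | hM
  · rw [Finset.Icc_eq_empty (by omega), sum_empty]
    have : (0 : ℝ) < 2 * σ - 1 := by linarith
    positivity
  have hanti : AntitoneOn (fun x : ℝ => x ^ (-(2 * σ))) (Set.Icc ((2 : ℕ) : ℝ) M) := by
    refine (Real.antitoneOn_rpow_Ioi_of_exponent_nonpos (by linarith)).mono ?_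
    intro x hx
    exact lt_of_lt_of_le (by norm_num) hx.1
  have hcmp := AntitoneOn.sum_le_integral_Ico (by omega : 2 ≤ M) hanti
  have hIco : ∑ i ∈ Finset.Ico 2 M, ((i + 1 : ℕ) : ℝ) ^ (-(2 * σ)) =
      ∑ l ∈ Icc 3 M, (l : ℝ) ^ (-(2 * σ)) := by
    rw [← Finset.Ico_add_one_right_eq_Icc, Finset.sum_Ico_eq_sum_range,
      Finset.sum_Ico_eq_sum_range, show M + 1 - 3 = M - 2 by omega]
    refine sum_congr rfl fun j _ => ?_
    push_cast; ring_nf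
  rw [hIco] at hcmp
  refine hcmp.trans ?_
  have h0 : (0 : ℝ) ∉ Set.uIcc ((2 : ℕ) : ℝ) (M : ℝ) := by
    intro h0
    rcases Set.mem_uIcc.mp h0 with ⟨h1, _⟩ | ⟨h1, _⟩
    · norm_num at h1
    · have : (3 : ℝ) ≤ M := by exact_mod_cast hM
      linarith
  have hint : ∫ x in ((2 : ℕ) : ℝ)..(M : ℝ), x ^ (-(2 * σ)) =
      ((M : ℝ) ^ (-(2 * σ) + 1) - ((2 : ℕ) : ℝ) ^ (-(2 * σ) + 1)) / (-(2 * σ) + 1) :=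
    integral_rpow (Or.inr ⟨by linarith, h0⟩)
  rw [hint]
  have hσ' : (0 : ℝ) < 2 * σ - 1 := by linarith
  have hM0 : (0 : ℝ) ≤ (M : ℝ) ^ (-(2 * σ) + 1) := by positivity
  have e2 : (-(2 * σ) + 1) = 1 - 2 * σ := by ring
  have hB : ((2 : ℕ) : ℝ) ^ (-(2 * σ) + 1) = (2 : ℝ) ^ (1 - 2 * σ) := by rw [e2]; norm_num
  set A := (M : ℝ) ^ (-(2 * σ) + 1) with hA
  rw [hB]
  have hneg : (-(2 * σ) + 1) = -(2 * σ - 1) := by ring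
  rw [hneg, div_neg, ← neg_div, neg_sub]
  exact div_le_div_of_nonneg_right (by linarith) hσ'.le

/-- **`Σ_{2 ≤ l ≤ M} l^{-2σ} ≤ 0.866`** for `σ > 0.95`. [cite: Pintz1976ElementaryIV, §3 (3.12) p. 425] -/
theorem sum_Icc_two_rpow_le {σ : ℝ} (hσ : 0.95 < σ) (M : ℕ) :
    ∑ l ∈ Icc 2 M, (l : ℝ) ^ (-(2 * σ)) ≤ 0.866 := by
  rcases lt_or_ge M 2 with hM | hM
  · rw [Finset.Icc_eq_empty (by omega), sum_empty]; norm_num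
  have e : Icc 2 M = insert 2 (Icc 3 M) := by
    ext l; simp only [mem_Icc, mem_insert]; omega
  rw [e, sum_insert (by simp)]
  have hσhalf : (1 : ℝ) / 2 < σ := by norm_num at hσ ⊢; linarith
  have h3 := sum_Icc_three_rpow_le hσhalf M
  have hA : (2 : ℝ) ^ (-(9 / 10 : ℝ)) ≤ 0.537 := two_rpow_neg_nine_tenths_le
  have h2σ : ((2 : ℕ) : ℝ) ^ (-(2 * σ)) ≤ 0.2685 := by
    have e2 : ((2 : ℕ) : ℝ) = (2 : ℝ) := by norm_num
    rw [e2]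
    have : (2 : ℝ) ^ (-(2 * σ)) ≤ (2 : ℝ) ^ (-(9 / 10 : ℝ) + (-1)) :=
      Real.rpow_le_rpow_of_exponent_le (by norm_num) (by norm_num at hσ ⊢; linarith)
    rw [Real.rpow_add (by norm_num), Real.rpow_neg_one] at this
    norm_num at hA this ⊢
    linarith
  have h1σ : (2 : ℝ) ^ (1 - 2 * σ) ≤ 0.537 :=
    (Real.rpow_le_rpow_of_exponent_le (by norm_num) (by norm_num at hσ ⊢; linarith)).trans hA
  have hden : (0.9 : ℝ) ≤ 2 * σ - 1 := by norm_num at hσ ⊢; linarith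
  have hfrac : (2 : ℝ) ^ (1 - 2 * σ) / (2 * σ - 1) ≤ 0.537 / 0.9 := by
    have h0 : (0 : ℝ) ≤ (2 : ℝ) ^ (1 - 2 * σ) := by positivity
    calc (2 : ℝ) ^ (1 - 2 * σ) / (2 * σ - 1) ≤ (2 : ℝ) ^ (1 - 2 * σ) / 0.9 :=
          div_le_div_of_nonneg_left h0 (by norm_num) hden
      _ ≤ 0.537 / 0.9 := by gcongr
  have h3' : ∑ l ∈ Icc 3 M, ((l : ℕ) : ℝ) ^ (-(2 * σ)) ≤ 0.537 / 0.9 := h3.trans hfrac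
  have hnum : (0.2685 : ℝ) + 0.537 / 0.9 ≤ 0.866 := by norm_num
  linarith

/-- **The lower bound (3.12)**: for `Re s = σ ∈ (0.95, 1]` and any character `χ_k`,
`‖Σ_{l ≤ M} χ_k(l²) (l²)^{-s}‖ ≥ 0.134` (`M ≥ 1`; any `Re s > 0.95`): the term `l = 1` is `1`, the others have
total size `≤ Σ_{l ≥ 2} l^{-2σ} ≤ 0.866`. [cite: Pintz1976ElementaryIV, §3 (3.12) p. 425] -/
theorem norm_sum_sq_ge {s : ℂ} (hσ : 0.95 < s.re) {M : ℕ} (hM : 1 ≤ M) :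
    0.134 ≤ ‖∑ l ∈ Ioc 0 M, χk ((l ^ 2 : ℕ) : ZMod k) * ((l ^ 2 : ℕ) : ℂ) ^ (-s)‖ := by
  have hsplit : ∑ l ∈ Ioc 0 M, χk ((l ^ 2 : ℕ) : ZMod k) * ((l ^ 2 : ℕ) : ℂ) ^ (-s) =
      1 + ∑ l ∈ Icc 2 M, χk ((l ^ 2 : ℕ) : ZMod k) * ((l ^ 2 : ℕ) : ℂ) ^ (-s) := by
    have e : Ioc 0 M = insert 1 (Icc 2 M) := by
      ext l; simp only [mem_Ioc, mem_insert, mem_Icc]; omega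
    rw [e, sum_insert (by simp)]
    simp
  rw [hsplit]
  have hrest : ‖∑ l ∈ Icc 2 M, χk ((l ^ 2 : ℕ) : ZMod k) * ((l ^ 2 : ℕ) : ℂ) ^ (-s)‖ ≤ 0.866 := by
    refine (norm_sum_le _ _).trans ((sum_le_sum fun l hl => ?_).trans
      (sum_Icc_two_rpow_le hσ M))
    have hl0 : 0 < l := by have := (mem_Icc.mp hl).1; omega
    rw [norm_mul, norm_natCast_cpow_of_pos (by positivity), neg_re]
    calc ‖χk ((l ^ 2 : ℕ) : ZMod k)‖ * ((l ^ 2 : ℕ) : ℝ) ^ (-s.re)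
        ≤ 1 * ((l ^ 2 : ℕ) : ℝ) ^ (-s.re) :=
          mul_le_mul_of_nonneg_right (χk.norm_le_one _) (by positivity)
      _ = (l : ℝ) ^ (-(2 * s.re)) := by
          rw [one_mul, Nat.cast_pow, ← Real.rpow_natCast, ← Real.rpow_mul (by positivity)]
          norm_num
  have h := norm_sub_norm_le (1 : ℂ)
    (-(∑ l ∈ Icc 2 M, χk ((l ^ 2 : ℕ) : ZMod k) * ((l ^ 2 : ℕ) : ℂ) ^ (-s)))
  rw [sub_neg_eq_add, norm_neg, norm_one] at h
  have h134 : (0.134 : ℝ) = 1 - 0.866 := by norm_num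
  rw [h134]
  linarith

/-! ### Part D — (3.13): `S(M)` is small because `L(s₀, χ_k) = 0` -/

/-- `χ_k χ_D` as a Dirichlet character mod `kD` (both lifted). [cite: Pintz1976ElementaryIV, Theorem 1 p. 422] -/
def prodChar : DirichletCharacter ℂ (k * q) :=
  DirichletCharacter.changeLevel (dvd_mul_right k q) χk *
    DirichletCharacter.changeLevel (dvd_mul_left q k) χ

/-- `(χ_k χ_D)(n) = χ_k(n) χ_D(n)` for every natural `n`. [cite: Pintz1976ElementaryIV, Theorem 1 p. 422 (χ_kχ_D)] -/
theorem prodChar_apply_natCast (n : ℕ) : prodChar χ χk n = χk n * χ n := by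
  rw [prodChar, MulChar.coeToFun_mul, Pi.mul_apply]
  by_cases h : (n : ℕ).Coprime (k * q)
  · have hk' : IsCoprime (n : ℤ) ((k * q : ℕ) : ℤ) := Nat.isCoprime_iff_coprime.mpr h
    have e1 := DirichletCharacter.changeLevel_eq_cast_of_dvd' χk (dvd_mul_right k q) hk'
    have e2 := DirichletCharacter.changeLevel_eq_cast_of_dvd' χ (dvd_mul_left q k) hk'
    simp only [Int.cast_natCast] at e1 e2
    rw [e1, e2]
  · have hnu : ¬ IsUnit ((n : ℕ) : ZMod (k * q)) := by
      rwa [ZMod.isUnit_iff_coprime]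
    rw [MulChar.map_nonunit _ hnu]
    rcases (not_and_or.mp fun hh => h (Nat.Coprime.mul_right hh.1 hh.2)) with h1 | h1
    · rw [MulChar.map_nonunit χk (by rwa [ZMod.isUnit_iff_coprime]), zero_mul, zero_mul]
    · rw [MulChar.map_nonunit χ (by rwa [ZMod.isUnit_iff_coprime]), mul_zero, zero_mul]

/-- The partial sums `T(w) = Σ_{l ≤ w} χ_k(l) l^{-s}` of `L(s, χ_k)`. [folklore] -/
def charPartial (s : ℂ) (w : ℕ) : ℂ := ∑ l ∈ Ioc 0 w, χk l * (l : ℂ) ^ (-s)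

/-- **(3.13), first identity**: `S(M) = Σ_{d ≤ M} χ_k(d)χ_D(d) d^{-s} T(M/d)`.
[cite: Pintz1976ElementaryIV, §3 (3.13) p. 425] -/
theorem innerSum_eq (hq : χ ^ 2 = 1) (s : ℂ) (M : ℕ) :
    innerSum χ χk s M =
      ∑ d ∈ Ioc 0 M, χk d * χ d * (d : ℂ) ^ (-s) * charPartial χk s (M / d) := by
  have h := sum_Ioc_sum_divisors_eq (fun d => χk d * χ d * (d : ℂ) ^ (-s))
    (fun l => χk l * (l : ℂ) ^ (-s)) M
  simp only [charPartial]
  rw [← h, innerSum]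
  refine sum_congr rfl fun m hm => ?_
  have hm0 : m ≠ 0 := (mem_Ioc.mp hm).1.ne'
  rw [ofReal_charDivisorSum_eq_sum χ hq, mul_sum]
  refine sum_congr rfl fun d hd => ?_
  have hdm : d ∣ m := Nat.dvd_of_mem_divisors hd
  obtain ⟨e, rfl⟩ := hdm
  have hd0 : d ≠ 0 := left_ne_zero_of_mul hm0
  have hc : ((d * e : ℕ) : ℂ) ^ (-s) = (d : ℂ) ^ (-s) * (e : ℂ) ^ (-s) := by
    rw [Nat.cast_mul]; exact natCast_mul_natCast_cpow d e (-s)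
  have hχ : χk ((d * e : ℕ) : ZMod k) = χk d * χk e := by rw [Nat.cast_mul, map_mul]
  rw [Nat.mul_div_cancel_left e (Nat.pos_of_ne_zero hd0), hχ, hc]
  ring

/-- **`‖T(w)‖ ≤ k(1 + ‖s‖/σ) w^{-σ}`** for `w ≥ 1` when `L(s, χ_k) = 0` (`χ_k ≠ χ₀`, `0 < σ = Re s`):
the partial sum is minus the tail (Abel summation with the trivial bound `|Σχ_k| ≤ k`).
[cite: Pintz1976ElementaryIV, §3 (3.13) p. 425–426] -/
theorem norm_charPartial_le [NeZero k] (hχk : χk ≠ 1) {s : ℂ} (hs : 0 < s.re)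
    (hL : χk.LFunction s = 0)
    {w : ℕ} (hw : 1 ≤ w) :
    ‖charPartial χk s w‖ ≤ (k : ℝ) * (1 + ‖s‖ / s.re) * (w : ℝ) ^ (-s.re) := by
  have h := Pintz1976Deuring.norm_sum_char_cpow_sub_LFunction_le χk hχk
    (norm_partialSum_le χk hχk) hs hw
  rwa [hL, sub_zero] at h

/-- **`‖Σ_{y < d ≤ Y} χ_k(d)χ_D(d) d^{-s}‖ ≤ 2kD(1 + ‖s‖/σ) y^{-σ}`** (`1 ≤ y ≤ Y`, `χ_kχ_D ≠ χ₀`).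
[cite: Pintz1976ElementaryIV, §3 (3.13) p. 425–426] -/
theorem norm_sum_Ioc_prodChar_le [NeZero k] [NeZero q] (hψ : prodChar χ χk ≠ 1) {s : ℂ}
    (hs : 0 < s.re) {y Y : ℕ}
    (hy : 1 ≤ y) (hyY : y ≤ Y) :
    ‖∑ d ∈ Ioc y Y, χk d * χ d * (d : ℂ) ^ (-s)‖ ≤
      2 * ((k * q : ℕ) : ℝ) * (1 + ‖s‖ / s.re) * (y : ℝ) ^ (-s.re) := by
  have h := Pintz1976Deuring.norm_sum_Ioc_char_cpow_le (prodChar χ χk) hψ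
    (norm_partialSum_le (prodChar χ χk) hψ) hs hy hyY
  have e : ∑ d ∈ Ioc y Y, (prodChar χ χk) d * (d : ℂ) ^ (-s) =
      ∑ d ∈ Ioc y Y, χk d * χ d * (d : ℂ) ^ (-s) :=
    sum_congr rfl fun d _ => by rw [prodChar_apply_natCast]
  rwa [e] at h

/-- `M ≤ 2 d ⌊M/d⌋` for `1 ≤ d ≤ M`. [folklore] -/
private theorem le_two_mul_mul_div {d M : ℕ} (hd : 1 ≤ d) (hdM : d ≤ M) :
    (M : ℝ) ≤ 2 * ((d : ℝ) * ((M / d : ℕ) : ℝ)) := by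
  have h1 : M < M / d * d + d := Nat.lt_div_mul_add (by omega)
  have h2 : 1 ≤ M / d := (Nat.one_le_div_iff (by omega)).mpr hdM
  have h3 : d ≤ M / d * d := Nat.le_mul_of_pos_left d h2
  have h4 : M + 1 ≤ 2 * (d * (M / d)) := by
    rw [mul_comm d]
    omega
  exact_mod_cast (Nat.le_succ M).trans h4

/-- `d^{-σ} ⌊M/d⌋^{-σ} ≤ 2 M^{-σ}` for `1 ≤ d ≤ M`, `0 ≤ σ ≤ 1`. [folklore] -/
private theorem rpow_mul_div_rpow_le {σ : ℝ} (hσ0 : 0 ≤ σ) (hσ1 : σ ≤ 1) {d M : ℕ} (hd : 1 ≤ d)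
    (hdM : d ≤ M) :
    (d : ℝ) ^ (-σ) * ((M / d : ℕ) : ℝ) ^ (-σ) ≤ 2 * (M : ℝ) ^ (-σ) := by
  have hd0 : (0 : ℝ) < d := by exact_mod_cast hd
  have hM0 : (0 : ℝ) < M := by exact_mod_cast (show 0 < M by omega)
  have hprod : (M : ℝ) / 2 ≤ (d : ℝ) * ((M / d : ℕ) : ℝ) := by
    have := le_two_mul_mul_div hd hdM
    linarith
  rw [← Real.mul_rpow hd0.le (Nat.cast_nonneg _)]
  calc ((d : ℝ) * ((M / d : ℕ) : ℝ)) ^ (-σ) ≤ ((M : ℝ) / 2) ^ (-σ) :=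
        Real.rpow_le_rpow_of_nonpos (by positivity) hprod (by linarith)
    _ = 2 ^ σ * (M : ℝ) ^ (-σ) := by
        rw [Real.div_rpow hM0.le (by norm_num), Real.rpow_neg (by norm_num : (0:ℝ) ≤ 2)]
        field_simp
    _ ≤ 2 ^ (1 : ℝ) * (M : ℝ) ^ (-σ) := by
        gcongr
        · norm_num
    _ = 2 * (M : ℝ) ^ (-σ) := by rw [Real.rpow_one]

/-- `Σ_{m ≤ K} 1/m ≤ 1 + log K`. [folklore] -/
private theorem sum_Ioc_inv_le (K : ℕ) : ∑ m ∈ Ioc 0 K, ((m : ℝ))⁻¹ ≤ 1 + Real.log K := by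
  have h := harmonic_le_one_add_log K
  have e : Ioc 0 K = Icc 1 K := rfl
  rw [e]
  simpa [harmonic_eq_sum_Icc, Rat.cast_sum, Rat.cast_inv, Rat.cast_natCast] using h

/-- `Σ_{m ≤ K} m^{-σ} ≤ K^{1-σ}(1 + log K)` for `σ ≤ 1`. [cite: Pintz1976ElementaryIV, §3 (3.13) p. 426] -/
theorem sum_Ioc_rpow_neg_le {σ : ℝ} (hσ1 : σ ≤ 1) (K : ℕ) :
    ∑ m ∈ Ioc 0 K, (m : ℝ) ^ (-σ) ≤ (K : ℝ) ^ (1 - σ) * (1 + Real.log K) := by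
  calc ∑ m ∈ Ioc 0 K, (m : ℝ) ^ (-σ) = ∑ m ∈ Ioc 0 K, (m : ℝ) ^ (1 - σ) * ((m : ℝ))⁻¹ := by
        refine sum_congr rfl fun m hm => ?_
        have hm0 : (0 : ℝ) < m := by exact_mod_cast (mem_Ioc.mp hm).1
        rw [← Real.rpow_neg_one, ← Real.rpow_add hm0]
        ring_nf
    _ ≤ ∑ m ∈ Ioc 0 K, (K : ℝ) ^ (1 - σ) * ((m : ℝ))⁻¹ := by
        refine sum_le_sum fun m hm => ?_
        have hm0 : (0 : ℝ) < m := by exact_mod_cast (mem_Ioc.mp hm).1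
        have hmK : (m : ℝ) ≤ K := by exact_mod_cast (mem_Ioc.mp hm).2
        exact mul_le_mul_of_nonneg_right (Real.rpow_le_rpow hm0.le hmK (by linarith))
          (inv_nonneg.mpr hm0.le)
    _ = (K : ℝ) ^ (1 - σ) * ∑ m ∈ Ioc 0 K, ((m : ℝ))⁻¹ := by rw [mul_sum]
    _ ≤ (K : ℝ) ^ (1 - σ) * (1 + Real.log K) :=
        mul_le_mul_of_nonneg_left (sum_Ioc_inv_le K) (by positivity)

/-- **(3.13)**: if `L(s, χ_k) = 0` (`0 < σ = Re s ≤ 1`), `χ_k ≠ χ₀` mod `k`, `χ_kχ_D ≠ χ₀`, then for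
every `M ≥ 1` (here for `½ ≤ σ ≤ 1`),
`‖S(M)‖ = ‖Σ_{m ≤ M} χ_k(m) m^{-s} g_D(m)‖ ≤ 4kD(1 + ‖s‖/σ)(2 + log M) M^{1/2 − σ}`
(hyperbola at `z = ⌊√M⌋`, tails by Abel summation with the trivial character-sum bounds `k`, `kD`).
[cite: Pintz1976ElementaryIV, §3 (3.13) p. 425–426] -/
theorem norm_innerSum_le [NeZero k] [NeZero q] (hq : χ ^ 2 = 1) (hχk : χk ≠ 1)
    (hψ : prodChar χ χk ≠ 1) {s : ℂ} (hhalf : 1 / 2 ≤ s.re) (hs1 : s.re ≤ 1)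
    (hL : χk.LFunction s = 0) {M : ℕ} (hM : 1 ≤ M) :
    ‖innerSum χ χk s M‖ ≤
      4 * ((k * q : ℕ) : ℝ) * (1 + ‖s‖ / s.re) * (2 + Real.log M) * (M : ℝ) ^ (1 / 2 - s.re) := by
  -- notation and the parameter `z = ⌊√M⌋`
  have hs0 : 0 < s.re := by linarith
  set σ : ℝ := s.re with hσdef
  set A : ℝ := 1 + ‖s‖ / σ with hAdef
  have hA0 : 0 ≤ A := by have : 0 ≤ ‖s‖ / σ := div_nonneg (norm_nonneg _) hs0.le; positivity
  set z : ℕ := Nat.sqrt M with hzdef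
  have hz1 : 1 ≤ z := Nat.succ_le_of_lt (Nat.sqrt_pos.mpr (by omega))
  have hzM : z ≤ M := Nat.sqrt_le_self M
  have hzsq : z ^ 2 ≤ M := Nat.sqrt_le' M
  have hzsq' : M < (z + 1) ^ 2 := Nat.lt_succ_sqrt' M
  have hM0 : (0 : ℝ) < M := by exact_mod_cast (show 0 < M by omega)
  have hz0 : (0 : ℝ) < z := by exact_mod_cast hz1
  have hk0 : (0 : ℝ) < k := by exact_mod_cast Nat.pos_of_ne_zero (NeZero.ne k)
  have hq1 : (1 : ℝ) ≤ q := by exact_mod_cast NeZero.one_le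
  have hkq : ((k * q : ℕ) : ℝ) = (k : ℝ) * q := by push_cast; ring
  -- `√M`: `z ≤ √M ≤ 2z`, `M^{1/2-σ} = √M · M^{-σ}`
  set R : ℝ := Real.sqrt M with hRdef
  have hR0 : 0 < R := Real.sqrt_pos.mpr hM0
  have hzR : (z : ℝ) ≤ R := by
    rw [hRdef, ← Real.sqrt_sq hz0.le]
    exact Real.sqrt_le_sqrt (by exact_mod_cast hzsq)
  have hRz : R ≤ 2 * z := by
    have h1 : R < (z : ℝ) + 1 := by
      rw [hRdef, ← Real.sqrt_sq (by positivity : (0:ℝ) ≤ (z : ℝ) + 1)]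
      exact Real.sqrt_lt_sqrt hM0.le (by exact_mod_cast hzsq')
    have h2 : (1 : ℝ) ≤ z := by exact_mod_cast hz1
    linarith
  have hRsq : R ^ 2 = M := Real.sq_sqrt hM0.le
  have hMpow : (M : ℝ) ^ (1 / 2 - σ) = R * (M : ℝ) ^ (-σ) := by
    rw [hRdef, Real.sqrt_eq_rpow, ← Real.rpow_add hM0]; ring_nf
  -- the functions
  set a : ℕ → ℂ := fun d => χk d * χ d * (d : ℂ) ^ (-s) with hadef
  set b : ℕ → ℂ := fun l => χk l * (l : ℂ) ^ (-s) with hbdef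
  have hTb : ∀ w, charPartial χk s w = ∑ l ∈ Ioc 0 w, b l := fun w => rfl
  have ha_norm : ∀ {d : ℕ}, 0 < d → ‖a d‖ ≤ (d : ℝ) ^ (-σ) := by
    intro d hd
    simp only [hadef, norm_mul, norm_natCast_cpow_of_pos hd, neg_re]
    have h1 := χk.norm_le_one (d : ZMod k)
    have h2 := χ.norm_le_one (d : ZMod q)
    have h3 : 0 ≤ (d : ℝ) ^ (-σ) := by positivity
    calc ‖χk d‖ * ‖χ d‖ * (d : ℝ) ^ (-σ) ≤ 1 * 1 * (d : ℝ) ^ (-σ) := by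
          gcongr
      _ = (d : ℝ) ^ (-σ) := by ring
  have hb_norm : ∀ {l : ℕ}, 0 < l → ‖b l‖ ≤ (l : ℝ) ^ (-σ) := by
    intro l hl
    simp only [hbdef, norm_mul, norm_natCast_cpow_of_pos hl, neg_re]
    have h1 := χk.norm_le_one (l : ZMod k)
    have h3 : 0 ≤ (l : ℝ) ^ (-σ) := by positivity
    calc ‖χk l‖ * (l : ℝ) ^ (-σ) ≤ 1 * (l : ℝ) ^ (-σ) := by gcongr
      _ = (l : ℝ) ^ (-σ) := by ring
  -- decomposition: `S(M) = Σ_{d ≤ z} a(d) T(M/d) + Σ_{l ≤ M} b(l) Σ_{z < d ≤ M/l} a(d)`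
  have hdec : innerSum χ χk s M =
      ∑ d ∈ Ioc 0 z, a d * charPartial χk s (M / d) +
        ∑ l ∈ Ioc 0 M, b l * ∑ d ∈ Ioc z (M / l), a d := by
    rw [← sum_Ioc_above_mul_sum_eq a b z M, innerSum_eq χ χk hq s M,
      ← sum_Ioc_consecutive _ (Nat.zero_le z) hzM]
    rfl
  -- first part
  have h1 : ‖∑ d ∈ Ioc 0 z, a d * charPartial χk s (M / d)‖ ≤ 2 * k * A * R * (M : ℝ) ^ (-σ) := by
    refine (norm_sum_le _ _).trans ?_
    have hterm : ∀ d ∈ Ioc 0 z, ‖a d * charPartial χk s (M / d)‖ ≤ 2 * k * A * (M : ℝ) ^ (-σ) := by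
      intro d hd
      have hd0 : 0 < d := (mem_Ioc.mp hd).1
      have hdM : d ≤ M := (mem_Ioc.mp hd).2.trans hzM
      have hw : 1 ≤ M / d := (Nat.one_le_div_iff hd0).mpr hdM
      rw [norm_mul]
      calc ‖a d‖ * ‖charPartial χk s (M / d)‖
          ≤ (d : ℝ) ^ (-σ) * ((k : ℝ) * A * ((M / d : ℕ) : ℝ) ^ (-σ)) :=
            mul_le_mul (ha_norm hd0) (norm_charPartial_le χk hχk hs0 hL hw) (norm_nonneg _)
              (by positivity)
        _ = (k : ℝ) * A * ((d : ℝ) ^ (-σ) * ((M / d : ℕ) : ℝ) ^ (-σ)) := by ring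
        _ ≤ (k : ℝ) * A * (2 * (M : ℝ) ^ (-σ)) :=
            mul_le_mul_of_nonneg_left (rpow_mul_div_rpow_le hs0.le hs1 hd0 hdM) (by positivity)
        _ = 2 * k * A * (M : ℝ) ^ (-σ) := by ring
    refine (sum_le_sum hterm).trans ?_
    rw [sum_const, Nat.card_Ioc, Nat.sub_zero, nsmul_eq_mul]
    have : (z : ℝ) * (2 * k * A * (M : ℝ) ^ (-σ)) ≤ R * (2 * k * A * (M : ℝ) ^ (-σ)) :=
      mul_le_mul_of_nonneg_right hzR (by positivity)
    linarith
  -- second part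
  have h2 : ‖∑ l ∈ Ioc 0 M, b l * ∑ d ∈ Ioc z (M / l), a d‖ ≤
      2 * ((k : ℝ) * q) * A * (z : ℝ) ^ (-σ) * ((z : ℝ) ^ (1 - σ) * (1 + Real.log z)) := by
    refine (norm_sum_le _ _).trans ?_
    have hterm : ∀ l ∈ Ioc 0 M, ‖b l * ∑ d ∈ Ioc z (M / l), a d‖ ≤
        if z < M / l then (l : ℝ) ^ (-σ) * (2 * ((k : ℝ) * q) * A * (z : ℝ) ^ (-σ)) else 0 := by
      intro l hl
      have hl0 : 0 < l := (mem_Ioc.mp hl).1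
      split_ifs with hzl
      · rw [norm_mul]
        refine mul_le_mul (hb_norm hl0) ?_ (norm_nonneg _) (by positivity)
        have := norm_sum_Ioc_prodChar_le χ χk hψ hs0 hz1 hzl.le
        rwa [hkq] at this
      · rw [Finset.Ioc_eq_empty (by omega), sum_empty, mul_zero, norm_zero]
    refine (sum_le_sum hterm).trans ?_
    rw [← sum_filter]
    have hsub : (Ioc 0 M).filter (fun l => z < M / l) ⊆ Ioc 0 z := by
      intro l hl
      rw [mem_filter, mem_Ioc] at hl
      rw [mem_Ioc]
      refine ⟨hl.1.1, ?_⟩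
      have h3 : (z + 1) * l ≤ M := (Nat.le_div_iff_mul_le hl.1.1).mp hl.2
      by_contra hcon
      have : (z + 1) * (z + 1) ≤ (z + 1) * l := Nat.mul_le_mul_left _ (by omega)
      nlinarith
    calc ∑ l ∈ (Ioc 0 M).filter (fun l => z < M / l),
          (l : ℝ) ^ (-σ) * (2 * ((k : ℝ) * q) * A * (z : ℝ) ^ (-σ))
        ≤ ∑ l ∈ Ioc 0 z, (l : ℝ) ^ (-σ) * (2 * ((k : ℝ) * q) * A * (z : ℝ) ^ (-σ)) :=
          sum_le_sum_of_subset_of_nonneg hsub fun l _ _ => by positivity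
      _ = (∑ l ∈ Ioc 0 z, (l : ℝ) ^ (-σ)) * (2 * ((k : ℝ) * q) * A * (z : ℝ) ^ (-σ)) := by
          rw [sum_mul]
      _ ≤ ((z : ℝ) ^ (1 - σ) * (1 + Real.log z)) * (2 * ((k : ℝ) * q) * A * (z : ℝ) ^ (-σ)) :=
          mul_le_mul_of_nonneg_right (sum_Ioc_rpow_neg_le hs1 z) (by positivity)
      _ = 2 * ((k : ℝ) * q) * A * (z : ℝ) ^ (-σ) * ((z : ℝ) ^ (1 - σ) * (1 + Real.log z)) := by
          ring
  -- sizes: `z^{-σ} z^{1-σ} = z^{1-2σ} ≤ (R/2)^{1-2σ} ≤ 2 R M^{-σ}`, `log z ≤ log M`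
  have hz_pow : (z : ℝ) ^ (-σ) * (z : ℝ) ^ (1 - σ) ≤ 2 * R * (M : ℝ) ^ (-σ) := by
    rw [← Real.rpow_add hz0]
    have e : -σ + (1 - σ) = 1 - 2 * σ := by ring
    rw [e]
    have hR2 : R / 2 ≤ z := by linarith
    calc (z : ℝ) ^ (1 - 2 * σ) ≤ (R / 2) ^ (1 - 2 * σ) :=
          Real.rpow_le_rpow_of_nonpos (by positivity) hR2 (by linarith)
      _ = R ^ (1 - 2 * σ) * (2 : ℝ) ^ (2 * σ - 1) := by
          rw [Real.div_rpow hR0.le (by norm_num),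
            show (2 * σ - 1) = -(1 - 2 * σ) by ring, Real.rpow_neg (by norm_num)]
          field_simp
      _ ≤ R ^ (1 - 2 * σ) * (2 : ℝ) ^ (1 : ℝ) := by
          gcongr
          · norm_num
          · linarith
      _ = 2 * R * (M : ℝ) ^ (-σ) := by
          rw [Real.rpow_one, hRdef, Real.sqrt_eq_rpow, ← Real.rpow_mul hM0.le,
            show (1 / 2 : ℝ) * (1 - 2 * σ) = 1 / 2 + -σ by ring, Real.rpow_add hM0,
            ← Real.sqrt_eq_rpow]
          ring
  have hlogz : Real.log z ≤ Real.log M :=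
    Real.log_le_log hz0 (by exact_mod_cast hzM)
  have hlogM : 0 ≤ Real.log M := Real.log_nonneg (by exact_mod_cast hM)
  -- assembly
  rw [hdec]
  refine (norm_add_le _ _).trans ?_
  rw [hkq, hMpow]
  have hk1 : (k : ℝ) ≤ (k : ℝ) * q := by nlinarith
  have h2' : ‖∑ l ∈ Ioc 0 M, b l * ∑ d ∈ Ioc z (M / l), a d‖ ≤
      2 * ((k : ℝ) * q) * A * (2 * R * (M : ℝ) ^ (-σ)) * (1 + Real.log M) := by
    refine h2.trans ?_
    have e : 2 * ((k : ℝ) * q) * A * (z : ℝ) ^ (-σ) * ((z : ℝ) ^ (1 - σ) * (1 + Real.log z)) =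
        2 * ((k : ℝ) * q) * A * ((z : ℝ) ^ (-σ) * (z : ℝ) ^ (1 - σ)) * (1 + Real.log z) := by ring
    rw [e]
    have hlz0 : 0 ≤ 1 + Real.log z := by
      have := Real.log_nonneg (show (1:ℝ) ≤ z by exact_mod_cast hz1); linarith
    gcongr
  have hMσ : 0 ≤ (M : ℝ) ^ (-σ) := by positivity
  nlinarith [mul_nonneg (mul_nonneg hA0 hR0.le) hMσ, mul_nonneg (mul_nonneg (mul_nonneg hA0 hR0.le) hMσ) hlogM,
    mul_nonneg (mul_nonneg (mul_nonneg hA0 hR0.le) hMσ) (sub_nonneg.mpr hk1)]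

/-! ### Part E — divisor-function sums: `Σ_{m ≤ M} τ(m)/m ≤ ½ log²M + 2 log M + 2` -/

/-- `Σ_{3 ≤ a < M} log a / a ≥ (log²M − log²3)/2` (integral comparison, `log x/x` decreasing on
`[e, ∞)`). [cite: Pintz1976ElementaryIV, §3 (3.17) p. 426 ((½ + o(1)) log²)] -/
theorem sum_Ico_log_div_ge {M : ℕ} (hM : 3 ≤ M) :
    (Real.log M ^ 2 - Real.log 3 ^ 2) / 2 ≤ ∑ a ∈ Finset.Ico 3 M, Real.log a / a := by
  have hanti : AntitoneOn (fun x : ℝ => Real.log x / x) (Set.Icc ((3 : ℕ) : ℝ) M) := by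
    refine Real.log_div_self_antitoneOn.mono fun x hx => ?_
    exact Real.exp_one_lt_three.le.trans (by exact_mod_cast hx.1)
  have h := AntitoneOn.integral_le_sum_Ico hM hanti
  refine le_trans (le_of_eq ?_) h
  have hderiv : ∀ x ∈ Set.uIcc ((3 : ℕ) : ℝ) (M : ℝ),
      HasDerivAt (fun x : ℝ => Real.log x * Real.log x / 2) (Real.log x / x) x := by
    intro x hx
    rw [Set.uIcc_of_le (by exact_mod_cast hM)] at hx
    have h3x : (3 : ℝ) ≤ x := by exact_mod_cast hx.1
    have hx0 : x ≠ 0 := by linarith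
    have h1 := ((Real.hasDerivAt_log hx0).mul (Real.hasDerivAt_log hx0)).div_const 2
    have e : (x⁻¹ * Real.log x + Real.log x * x⁻¹) / 2 = Real.log x / x := by ring
    rw [e] at h1
    exact h1
  have hint : IntervalIntegrable (fun x : ℝ => Real.log x / x) MeasureTheory.volume
      ((3 : ℕ) : ℝ) (M : ℝ) := by
    refine ContinuousOn.intervalIntegrable ?_
    rw [Set.uIcc_of_le (by exact_mod_cast hM)]
    refine ContinuousOn.div (Real.continuousOn_log.mono ?_) continuousOn_id ?_
    · intro x hx
      have h3x : (3 : ℝ) ≤ x := by exact_mod_cast hx.1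
      simp only [Set.mem_compl_iff, Set.mem_singleton_iff]
      linarith
    · intro x hx
      have h3x : (3 : ℝ) ≤ x := by exact_mod_cast hx.1
      exact (show (0 : ℝ) < id x by simpa using (by linarith : (0 : ℝ) < x)).ne'
  rw [intervalIntegral.integral_eq_sub_of_hasDerivAt hderiv hint]
  push_cast
  ring

/-- **`Σ_{1 ≤ a ≤ M} log a / a ≥ ½ log²M − 1`** (`log²3/2 < 1`). [cite: Pintz1976ElementaryIV, §3 (3.17) p. 426 ((½ + o(1)) log²)] -/
theorem half_log_sq_sub_one_le_sum (M : ℕ) :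
    Real.log M ^ 2 / 2 - 1 ≤ ∑ a ∈ Ioc 0 M, Real.log a / a := by
  have hlog3 : Real.log 3 ^ 2 / 2 ≤ 1 := by
    have h4 : Real.log 3 ≤ Real.log 4 := Real.log_le_log (by norm_num) (by norm_num)
    have h4' : Real.log 4 = 2 * Real.log 2 := by
      rw [show (4 : ℝ) = 2 ^ 2 by norm_num, Real.log_pow]; norm_num
    have h2 := Real.log_two_lt_d9
    have h0 : 0 ≤ Real.log 3 := Real.log_nonneg (by norm_num)
    nlinarith
  have hnn : ∀ a ∈ Ioc 0 M, 0 ≤ Real.log a / a := fun a ha =>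
    div_nonneg (Real.log_nonneg (by exact_mod_cast (mem_Ioc.mp ha).1)) (Nat.cast_nonneg _)
  rcases lt_or_ge M 3 with hM | hM
  · have hlogM : Real.log M ^ 2 / 2 ≤ 1 := by
      have h1 : Real.log M ≤ Real.log 3 := by
        rcases Nat.eq_zero_or_pos M with rfl | hM0
        · simp; exact Real.log_nonneg (by norm_num)
        · exact Real.log_le_log (by exact_mod_cast hM0) (by exact_mod_cast hM.le)
      have h0 : 0 ≤ Real.log M := by
        rcases Nat.eq_zero_or_pos M with rfl | hM0
        · simp
        · exact Real.log_nonneg (by exact_mod_cast hM0)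
      nlinarith
    have := sum_nonneg hnn
    linarith
  · have hsub : Finset.Ico 3 M ⊆ Ioc 0 M := fun a ha => by
      rw [Finset.mem_Ico] at ha; rw [mem_Ioc]; omega
    have h := sum_Ico_log_div_ge hM
    have h2 := sum_le_sum_of_subset_of_nonneg hsub fun a ha _ => hnn a ha
    linarith

/-- **`Σ_{m ≤ M} τ(m)/m ≤ ½ log²M + 2 log M + 2`** (hyperbola: `= Σ_{a ≤ M} (1/a) H(M/a)`,
`H(x) ≤ 1 + log x`, and the previous lemma). [cite: Pintz1976ElementaryIV, §3 (3.14) and (3.17) p. 426] -/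
theorem sum_card_divisors_div_le (M : ℕ) :
    ∑ m ∈ Ioc 0 M, (m.divisors.card : ℝ) / m ≤
      Real.log M ^ 2 / 2 + 2 * Real.log M + 2 := by
  have hM0 : 0 ≤ Real.log M := by
    rcases Nat.eq_zero_or_pos M with rfl | hM0
    · simp
    · exact Real.log_nonneg (by exact_mod_cast hM0)
  -- `τ(m)/m = Σ_{d ∣ m} (1/d)(1/(m/d))`
  have h1 : ∑ m ∈ Ioc 0 M, (m.divisors.card : ℝ) / m =
      ∑ m ∈ Ioc 0 M, ∑ d ∈ m.divisors, (1 / (d : ℝ)) * (1 / ((m / d : ℕ) : ℝ)) := by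
    refine sum_congr rfl fun m hm => ?_
    have hm0 : m ≠ 0 := (mem_Ioc.mp hm).1.ne'
    rw [Finset.card_eq_sum_ones, Nat.cast_sum, sum_div]
    refine sum_congr rfl fun d hd => ?_
    have hdm : d ∣ m := Nat.dvd_of_mem_divisors hd
    obtain ⟨e, rfl⟩ := hdm
    have hd0 : d ≠ 0 := left_ne_zero_of_mul hm0
    rw [Nat.mul_div_cancel_left e (Nat.pos_of_ne_zero hd0)]
    push_cast
    rw [one_div_mul_one_div]
  have hhyp := sum_Ioc_sum_divisors_eq (fun d => 1 / (d : ℝ)) (fun e => 1 / (e : ℝ)) M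
  rw [h1, hhyp]
  -- inner harmonic sums: `H(M/a) ≤ 1 + log M − log a`
  have h2 : ∀ a ∈ Ioc 0 M, (1 / (a : ℝ)) * ∑ m ∈ Ioc 0 (M / a), 1 / (m : ℝ) ≤
      (1 / (a : ℝ)) * (1 + Real.log M) - Real.log a / a := by
    intro a ha
    have ha0 : 0 < a := (mem_Ioc.mp ha).1
    have haM : a ≤ M := (mem_Ioc.mp ha).2
    have ha0' : (0 : ℝ) < a := by exact_mod_cast ha0
    have hMa : 1 ≤ M / a := (Nat.one_le_div_iff ha0).mpr haM
    have hH : ∑ m ∈ Ioc 0 (M / a), 1 / (m : ℝ) ≤ 1 + Real.log ((M / a : ℕ) : ℝ) := by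
      have := sum_Ioc_inv_le (M / a)
      simpa [one_div] using this
    have hlog : Real.log ((M / a : ℕ) : ℝ) ≤ Real.log M - Real.log a := by
      rw [← Real.log_div (by exact_mod_cast (show M ≠ 0 by omega)) ha0'.ne']
      exact Real.log_le_log (by exact_mod_cast hMa) (Nat.cast_div_le)
    have e : (1 / (a : ℝ)) * (1 + Real.log M) - Real.log a / a =
        (1 / (a : ℝ)) * (1 + (Real.log M - Real.log a)) := by ring
    rw [e]
    exact mul_le_mul_of_nonneg_left (hH.trans (by linarith)) (by positivity)
  refine (sum_le_sum h2).trans ?_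
  rw [sum_sub_distrib, ← sum_mul]
  have h3 : ∑ a ∈ Ioc 0 M, 1 / (a : ℝ) ≤ 1 + Real.log M := by
    have := sum_Ioc_inv_le M
    simpa [one_div] using this
  have h4 := half_log_sq_sub_one_le_sum M
  have h5 : (∑ a ∈ Ioc 0 M, 1 / (a : ℝ)) * (1 + Real.log M) ≤ (1 + Real.log M) * (1 + Real.log M) :=
    mul_le_mul_of_nonneg_right h3 (by positivity)
  nlinarith

/-! ### Part F — (3.16): `Σ_{V³ < c ≤ V⁶} g_D(c)/c = 3 log V · L(1, χ_D) + O(log V / V)` -/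

/-- `Σ_{n ≤ M} g_D(n)/n` in complex form (the shape of the tree's Exercise 11.2.3(g)). [folklore] -/
def divSumC (M : ℕ) : ℂ := ∑ n ∈ Icc 1 M, (∑ d ∈ n.divisors, χ d) / (n : ℂ)

/-- `Σ_{N₁ < c ≤ N} g_D(c)/c = G(N) − G(N₁)` (real block as a difference of the complex sums). [cite: Pintz1976ElementaryIV, §3 (3.16) p. 426] -/
theorem ofReal_sum_Ioc_charDivisorSum_div (hq : χ ^ 2 = 1) {N₁ N : ℕ} (h : N₁ ≤ N) :
    ((∑ c ∈ Ioc N₁ N, charDivisorSum χ c / (c : ℝ) : ℝ) : ℂ) = divSumC χ N - divSumC χ N₁ := by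
  have e : ∀ M : ℕ, divSumC χ M = ∑ c ∈ Ioc 0 M, ((charDivisorSum χ c / (c : ℝ) : ℝ) : ℂ) := by
    intro M
    rw [divSumC, show Icc 1 M = Ioc 0 M from rfl]
    refine sum_congr rfl fun c _ => ?_
    rw [ofReal_div, ofReal_charDivisorSum_eq_sum χ hq, ofReal_natCast]
  rw [e, e, ← sum_Ioc_consecutive _ (Nat.zero_le N₁) h, ofReal_sum]
  ring

/-- **(3.16)**: for quadratic `χ_D ≠ χ₀` mod `D ≤ 3V`, `V ≥ 2`:
`Σ_{V³ < c ≤ V⁶} g_D(c)/c ≤ 3 log V · L(1, χ_D) + 300 log V / V` (the tree's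
`DirichletAbel.norm_sum_divisorSum_div_sub_le` = Montgomery–Vaughan Ex. 11.2.3(g), differenced,
with the trivial bound `|Σχ_D| ≤ D`; Pintz cites Lemma 1 of part II).
[cite: Pintz1976ElementaryIV, §3 (3.16) p. 426] -/
theorem sum_charDivisorSum_div_le [NeZero q] (hq : χ ^ 2 = 1) (hχ : χ ≠ 1) {V : ℕ} (hV : 2 ≤ V)
    (hqV : (q : ℝ) ≤ 3 * V) :
    ∑ c ∈ Ioc (V ^ 3) ((V ^ 3) ^ 2), charDivisorSum χ c / (c : ℝ) ≤
      3 * Real.log V * (χ.LFunction 1).re + 300 * Real.log V / (V : ℝ) := by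
  have hV0 : (0 : ℝ) < V := by exact_mod_cast (show 0 < V by omega)
  have hV2 : (2 : ℝ) ≤ V := by exact_mod_cast hV
  have hL0 : Real.log 2 ≤ Real.log V := Real.log_le_log (by norm_num) hV2
  have hlog2 : (0.69 : ℝ) ≤ Real.log 2 := by
    have := Real.log_two_gt_d9; norm_num at this ⊢; linarith
  have hL : (0.69 : ℝ) ≤ Real.log V := hlog2.trans hL0
  set N₁ : ℕ := V ^ 3 with hN₁
  set N : ℕ := N₁ ^ 2 with hN
  have hN₁2 : 2 ≤ N₁ := le_trans hV (Nat.le_self_pow (by norm_num) V)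
  have hV2N₁ : V ^ 2 ≤ N₁ := Nat.pow_le_pow_right (by omega) (by norm_num)
  have hV2' : 2 ≤ V ^ 2 := le_trans hV (Nat.le_self_pow (by norm_num) V)
  have hN₁N : N₁ ≤ N := Nat.le_self_pow (by norm_num) N₁
  have hB := norm_partialSum_le χ hχ
  have e1 := norm_sum_divisorSum_div_sub_le χ hχ hB hN₁2 hN₁N
  have e2 := norm_sum_divisorSum_div_sub_le χ hχ hB hV2' hV2N₁
  -- real logs of the natural numbers involved
  have hlogN₁ : Real.log (N₁ : ℝ) = 3 * Real.log V := by
    rw [hN₁, Nat.cast_pow, Real.log_pow]; norm_num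
  have hlogN : Real.log (N : ℝ) = 6 * Real.log V := by
    rw [hN, Nat.cast_pow, Real.log_pow, hlogN₁]; push_cast; ring
  -- the identity `G = (divSumC N - main N) - (divSumC N₁ - main N₁) + (main N - main N₁)`
  set L : ℂ := χ.LFunction 1
  set L' : ℂ := deriv χ.LFunction 1
  set mN : ℂ := (((Real.log N + Real.eulerMascheroniConstant : ℝ)) : ℂ) * L + L'
  set mN₁ : ℂ := (((Real.log N₁ + Real.eulerMascheroniConstant : ℝ)) : ℂ) * L + L'
  have hmain : mN - mN₁ = ((3 * Real.log V : ℝ) : ℂ) * L := by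
    simp only [mN, mN₁, hlogN, hlogN₁]
    push_cast
    ring
  have hG : ((∑ c ∈ Ioc N₁ N, charDivisorSum χ c / (c : ℝ) : ℝ) : ℂ) =
      (divSumC χ N - mN) - (divSumC χ N₁ - mN₁) + ((3 * Real.log V : ℝ) : ℂ) * L := by
    rw [ofReal_sum_Ioc_charDivisorSum_div χ hq hN₁N, ← hmain]; ring
  have hre : ∑ c ∈ Ioc N₁ N, charDivisorSum χ c / (c : ℝ) =
      ((divSumC χ N - mN) - (divSumC χ N₁ - mN₁)).re + 3 * Real.log V * L.re := by
    have := congrArg Complex.re hG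
    rw [ofReal_re] at this
    rw [this, add_re, re_ofReal_mul]
  rw [hre]
  have hre_le : ((divSumC χ N - mN) - (divSumC χ N₁ - mN₁)).re ≤
      ‖divSumC χ N - mN‖ + ‖divSumC χ N₁ - mN₁‖ :=
    (re_le_norm _).trans (norm_sub_le _ _)
  -- numerical bounds for the two error terms
  have hq0 : (0 : ℝ) ≤ q := Nat.cast_nonneg q
  have hN₁r : (N₁ : ℝ) = (V : ℝ) ^ 3 := by rw [hN₁]; push_cast; ring
  have hNr : (N : ℝ) = (V : ℝ) ^ 6 := by rw [hN, hN₁]; push_cast; ring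
  have hE1 : ‖divSumC χ N - mN‖ ≤ (144 * Real.log V + 24) / (V : ℝ) ^ 2 + 4 / (V : ℝ) ^ 3 := by
    refine e1.trans ?_
    rw [hlogN, hN₁r, hNr]
    have h1 : 8 * (q : ℝ) * (6 * Real.log V + 1) / ((V : ℝ) ^ 3 + 1) ≤
        (144 * Real.log V + 24) / (V : ℝ) ^ 2 := by
      rw [div_le_div_iff₀ (by positivity) (by positivity)]
      have : 8 * (q : ℝ) * (6 * Real.log V + 1) ≤ 24 * V * (6 * Real.log V + 1) := by
        have : 0 ≤ 6 * Real.log V + 1 := by linarith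
        nlinarith
      nlinarith [pow_pos hV0 2, pow_pos hV0 3, mul_nonneg (by linarith : (0:ℝ) ≤ 6 * Real.log V + 1) hV0.le]
    have h2 : 4 * ((V : ℝ) ^ 3) / (V : ℝ) ^ 6 = 4 / (V : ℝ) ^ 3 := by
      rw [div_eq_div_iff (by positivity) (by positivity)]; ring
    linarith [h1, h2.le]
  have hE2 : ‖divSumC χ N₁ - mN₁‖ ≤ (72 * Real.log V + 24) / (V : ℝ) + 4 / (V : ℝ) := by
    refine e2.trans ?_
    rw [hlogN₁, hN₁r]
    push_cast
    have h1 : 8 * (q : ℝ) * (3 * Real.log V + 1) / ((V : ℝ) ^ 2 + 1) ≤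
        (72 * Real.log V + 24) / (V : ℝ) := by
      rw [div_le_div_iff₀ (by positivity) hV0]
      have : 8 * (q : ℝ) * (3 * Real.log V + 1) ≤ 24 * V * (3 * Real.log V + 1) := by
        have : 0 ≤ 3 * Real.log V + 1 := by linarith
        nlinarith
      nlinarith [pow_pos hV0 2, mul_nonneg (by linarith : (0:ℝ) ≤ 3 * Real.log V + 1) hV0.le]
    have h2 : 4 * ((V : ℝ) ^ 2) / (V : ℝ) ^ 3 = 4 / (V : ℝ) := by
      rw [div_eq_div_iff (by positivity) hV0.ne']; ring
    linarith [h1, h2.le]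
  -- `(144 L + 24)/V² + 4/V³ + (72 L + 24)/V + 4/V ≤ 300 L / V` for `V ≥ 2`, `L ≥ 0.69`
  have hV1 : (1 : ℝ) / (V : ℝ) ^ 2 ≤ 1 / (2 * (V : ℝ)) := by
    rw [div_le_div_iff₀ (by positivity) (by positivity)]; nlinarith
  have hV3 : (1 : ℝ) / (V : ℝ) ^ 3 ≤ 1 / (4 * (V : ℝ)) := by
    rw [div_le_div_iff₀ (by positivity) (by positivity)]; nlinarith
  have hfin : (144 * Real.log V + 24) / (V : ℝ) ^ 2 + 4 / (V : ℝ) ^ 3 +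
      ((72 * Real.log V + 24) / (V : ℝ) + 4 / (V : ℝ)) ≤ 300 * Real.log V / (V : ℝ) := by
    have ha : (144 * Real.log V + 24) / (V : ℝ) ^ 2 ≤
        (144 * Real.log V + 24) / (2 * (V : ℝ)) := by
      have : 0 ≤ 144 * Real.log V + 24 := by linarith
      calc (144 * Real.log V + 24) / (V : ℝ) ^ 2
          = (144 * Real.log V + 24) * (1 / (V : ℝ) ^ 2) := by ring
        _ ≤ (144 * Real.log V + 24) * (1 / (2 * (V : ℝ))) := mul_le_mul_of_nonneg_left hV1 this
        _ = (144 * Real.log V + 24) / (2 * (V : ℝ)) := by ring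
    have hb : (4 : ℝ) / (V : ℝ) ^ 3 ≤ 4 / (4 * (V : ℝ)) := by
      calc (4 : ℝ) / (V : ℝ) ^ 3 = 4 * (1 / (V : ℝ) ^ 3) := by ring
        _ ≤ 4 * (1 / (4 * (V : ℝ))) := mul_le_mul_of_nonneg_left hV3 (by norm_num)
        _ = 4 / (4 * (V : ℝ)) := by ring
    have hc : (144 * Real.log V + 24) / (2 * (V : ℝ)) + 4 / (4 * (V : ℝ)) +
        ((72 * Real.log V + 24) / (V : ℝ) + 4 / (V : ℝ)) = (144 * Real.log V + 41) / (V : ℝ) := by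
      field_simp; ring
    have hd : (144 * Real.log V + 41) / (V : ℝ) ≤ 300 * Real.log V / (V : ℝ) := by
      apply div_le_div_of_nonneg_right _ hV0.le
      linarith
    linarith
  linarith

/-! ### Part G — (3.14) and (3.17): the two ranges `c ≤ V³` and `V³ < c ≤ V⁶` -/

/-- Termwise size: `‖f(c) χ_k(c) c^{-s} S‖ ≤ g_D(c) c^{-σ} ‖S‖`. [cite: Pintz1976ElementaryIV, §3 (3.12) p. 425] -/
theorem norm_weight_term_le (hq : χ ^ 2 = 1) (s : ℂ) {c : ℕ} (hc : 0 < c) (S : ℂ) :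
    ‖((weight χ c : ℝ) : ℂ) * χk c * (c : ℂ) ^ (-s) * S‖ ≤
      charDivisorSum χ c * (c : ℝ) ^ (-s.re) * ‖S‖ := by
  rw [norm_mul, norm_mul, norm_mul, norm_real, Real.norm_eq_abs, norm_natCast_cpow_of_pos hc,
    neg_re]
  have h1 := abs_weight_le_charDivisorSum χ hq c
  have h2 := χk.norm_le_one (c : ZMod k)
  have h3 : 0 ≤ (c : ℝ) ^ (-s.re) := by positivity
  have h4 : 0 ≤ charDivisorSum χ c := charDivisorSum_nonneg χ hq c
  calc |weight χ c| * ‖χk c‖ * (c : ℝ) ^ (-s.re) * ‖S‖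
      ≤ charDivisorSum χ c * 1 * (c : ℝ) ^ (-s.re) * ‖S‖ := by gcongr
    _ = charDivisorSum χ c * (c : ℝ) ^ (-s.re) * ‖S‖ := by ring

/-- The trivial bound `‖S(M)‖ ≤ Σ_{m ≤ M} τ(m) m^{-σ}`. [cite: Pintz1976ElementaryIV, §3 (3.12) p. 425 (Σ₂)] -/
theorem norm_innerSum_le_sum (s : ℂ) (M : ℕ) :
    ‖innerSum χ χk s M‖ ≤ ∑ m ∈ Ioc 0 M, (m.divisors.card : ℝ) * (m : ℝ) ^ (-s.re) := by
  refine (norm_sum_le _ _).trans (sum_le_sum fun m hm => ?_)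
  have hm0 : 0 < m := (mem_Ioc.mp hm).1
  rw [norm_mul, norm_mul, norm_real, Real.norm_eq_abs, norm_natCast_cpow_of_pos hm0, neg_re]
  have h1 := abs_charDivisorSum_le χ m
  have h2 := χk.norm_le_one (m : ZMod k)
  have h3 : 0 ≤ (m : ℝ) ^ (-s.re) := by positivity
  calc ‖χk m‖ * (m : ℝ) ^ (-s.re) * |charDivisorSum χ m|
      ≤ 1 * (m : ℝ) ^ (-s.re) * (m.divisors.card : ℝ) := by gcongr
    _ = (m.divisors.card : ℝ) * (m : ℝ) ^ (-s.re) := by ring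

/-- **(3.14), the range `c ≤ N₁`** (`N = N₁²`): using (3.13) for `S(N/c)` (`N/c ≥ N₁`),
`Σ_{c ≤ N₁} g_D(c) c^{-σ} ‖S(N/c)‖ ≤ (Σ_{c ≤ N₁} τ(c)/c) · N₁^{1-σ} · 4kD(1 + ‖s‖/σ)(2 + log N) N₁^{1/2-σ}`.
[cite: Pintz1976ElementaryIV, §3 (3.14) p. 426] -/
theorem sigma_one_le [NeZero k] [NeZero q] (hq : χ ^ 2 = 1) (hχk : χk ≠ 1)
    (hψ : prodChar χ χk ≠ 1) {s : ℂ} (hhalf : 1 / 2 ≤ s.re) (hs1 : s.re ≤ 1)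
    (hL : χk.LFunction s = 0) {N₁ : ℕ} (hN₁ : 1 ≤ N₁) :
    ∑ c ∈ Ioc 0 N₁, charDivisorSum χ c * (c : ℝ) ^ (-s.re) * ‖innerSum χ χk s (N₁ ^ 2 / c)‖ ≤
      (∑ c ∈ Ioc 0 N₁, (c.divisors.card : ℝ) / c) *
        ((N₁ : ℝ) ^ (1 - s.re) * (4 * ((k * q : ℕ) : ℝ) * (1 + ‖s‖ / s.re) *
          (2 + Real.log ((N₁ ^ 2 : ℕ) : ℝ)) * (N₁ : ℝ) ^ (1 / 2 - s.re))) := by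
  have hs0 : 0 < s.re := by linarith
  have hN₁0 : (0 : ℝ) < N₁ := by exact_mod_cast hN₁
  set B : ℝ := 4 * ((k * q : ℕ) : ℝ) * (1 + ‖s‖ / s.re) *
    (2 + Real.log ((N₁ ^ 2 : ℕ) : ℝ)) * (N₁ : ℝ) ^ (1 / 2 - s.re) with hB
  have hA0 : 0 ≤ 1 + ‖s‖ / s.re := by
    have : 0 ≤ ‖s‖ / s.re := div_nonneg (norm_nonneg _) hs0.le; positivity
  have hlogN : 0 ≤ Real.log ((N₁ ^ 2 : ℕ) : ℝ) :=
    Real.log_nonneg (by exact_mod_cast Nat.one_le_pow _ _ (by omega))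
  have hB0 : 0 ≤ B := by positivity
  rw [sum_mul]
  refine sum_le_sum fun c hc => ?_
  have hc0 : 0 < c := (mem_Ioc.mp hc).1
  have hcN₁ : c ≤ N₁ := (mem_Ioc.mp hc).2
  have hc0' : (0 : ℝ) < c := by exact_mod_cast hc0
  -- `M = N/c ≥ N₁ ≥ 1`
  have hMN₁ : N₁ ≤ N₁ ^ 2 / c := by
    have h1 : N₁ ^ 2 / N₁ ≤ N₁ ^ 2 / c := Nat.div_le_div_left hcN₁ hc0
    have h2 : N₁ ^ 2 / N₁ = N₁ := by rw [sq, Nat.mul_div_cancel_left N₁ (by omega)]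
    rwa [h2] at h1
  have hM1 : 1 ≤ N₁ ^ 2 / c := hN₁.trans hMN₁
  have hMN : N₁ ^ 2 / c ≤ N₁ ^ 2 := Nat.div_le_self _ _
  have hM0 : (0 : ℝ) < ((N₁ ^ 2 / c : ℕ) : ℝ) := by exact_mod_cast hM1
  -- `‖S(M)‖ ≤ B`
  have hS : ‖innerSum χ χk s (N₁ ^ 2 / c)‖ ≤ B := by
    refine (norm_innerSum_le χ χk hq hχk hψ hhalf hs1 hL hM1).trans ?_
    have hlog : Real.log ((N₁ ^ 2 / c : ℕ) : ℝ) ≤ Real.log ((N₁ ^ 2 : ℕ) : ℝ) :=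
      Real.log_le_log hM0 (by exact_mod_cast hMN)
    have hpow : ((N₁ ^ 2 / c : ℕ) : ℝ) ^ (1 / 2 - s.re) ≤ (N₁ : ℝ) ^ (1 / 2 - s.re) :=
      Real.rpow_le_rpow_of_nonpos hN₁0 (by exact_mod_cast hMN₁) (by linarith)
    have hlogM : 0 ≤ Real.log ((N₁ ^ 2 / c : ℕ) : ℝ) := Real.log_nonneg (by exact_mod_cast hM1)
    simp only [hB]
    gcongr
  -- `g_D(c) c^{-σ} ≤ (τ(c)/c) N₁^{1-σ}`
  have hτ : charDivisorSum χ c ≤ (c.divisors.card : ℝ) :=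
    (le_abs_self _).trans (abs_charDivisorSum_le χ c)
  have hr0 : 0 ≤ charDivisorSum χ c := charDivisorSum_nonneg χ hq c
  have hcpow : (c : ℝ) ^ (-s.re) ≤ (1 / (c : ℝ)) * (N₁ : ℝ) ^ (1 - s.re) := by
    have e : (c : ℝ) ^ (-s.re) = (1 / (c : ℝ)) * (c : ℝ) ^ (1 - s.re) := by
      rw [one_div, ← Real.rpow_neg_one, ← Real.rpow_add hc0']; ring_nf
    rw [e]
    exact mul_le_mul_of_nonneg_left
      (Real.rpow_le_rpow hc0'.le (by exact_mod_cast hcN₁) (by linarith)) (by positivity)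
  calc charDivisorSum χ c * (c : ℝ) ^ (-s.re) * ‖innerSum χ χk s (N₁ ^ 2 / c)‖
      ≤ (c.divisors.card : ℝ) * ((1 / (c : ℝ)) * (N₁ : ℝ) ^ (1 - s.re)) * B := by
        gcongr
    _ = (c.divisors.card : ℝ) / c * ((N₁ : ℝ) ^ (1 - s.re) * B) := by ring

/-- **(3.17), the range `N₁ < c ≤ N`** (`N = N₁²`): with `S` bounded trivially and
`(cm)^{-σ} ≤ N^{1-σ}/(cm)`,
`Σ_{N₁ < c ≤ N} g_D(c) c^{-σ} ‖S(N/c)‖ ≤ N^{1-σ} (½log²N₁ + 2 log N₁ + 2) Σ_{N₁ < c ≤ N} g_D(c)/c`.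
[cite: Pintz1976ElementaryIV, §3 (3.17) p. 426] -/
theorem sigma_two_le (hq : χ ^ 2 = 1) {s : ℂ} (hs1 : s.re ≤ 1) {N₁ : ℕ} (hN₁ : 1 ≤ N₁) :
    ∑ c ∈ Ioc N₁ (N₁ ^ 2), charDivisorSum χ c * (c : ℝ) ^ (-s.re) *
        ‖innerSum χ χk s (N₁ ^ 2 / c)‖ ≤
      ((N₁ ^ 2 : ℕ) : ℝ) ^ (1 - s.re) * (Real.log N₁ ^ 2 / 2 + 2 * Real.log N₁ + 2) *
        ∑ c ∈ Ioc N₁ (N₁ ^ 2), charDivisorSum χ c / c := by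
  have hN₁0 : (0 : ℝ) < N₁ := by exact_mod_cast hN₁
  have hlogN₁ : 0 ≤ Real.log N₁ := Real.log_nonneg (by exact_mod_cast hN₁)
  set N : ℕ := N₁ ^ 2 with hN
  set Q : ℝ := Real.log N₁ ^ 2 / 2 + 2 * Real.log N₁ + 2 with hQ
  have hQ0 : 0 ≤ Q := by positivity
  have hNpow0 : 0 ≤ (N : ℝ) ^ (1 - s.re) := by positivity
  rw [mul_sum]
  refine sum_le_sum fun c hc => ?_
  have hN₁c : N₁ < c := (mem_Ioc.mp hc).1
  have hcN : c ≤ N := (mem_Ioc.mp hc).2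
  have hc0 : 0 < c := by omega
  have hc0' : (0 : ℝ) < c := by exact_mod_cast hc0
  have hr0 : 0 ≤ charDivisorSum χ c := charDivisorSum_nonneg χ hq c
  -- `M = N/c ≤ N₁`, `M ≥ 1`
  have hM1 : 1 ≤ N / c := (Nat.one_le_div_iff hc0).mpr hcN
  have hMN₁ : N / c ≤ N₁ := by
    have h1 : N / c ≤ N / N₁ := Nat.div_le_div_left (by omega) (by omega)
    have h2 : N / N₁ = N₁ := by rw [hN, sq, Nat.mul_div_cancel_left N₁ (by omega)]
    rwa [h2] at h1
  -- trivial bound for `S`, then `(cm)^{-σ} ≤ N^{1-σ}/(cm)`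
  have hS := norm_innerSum_le_sum χ χk s (N / c)
  have hterm : ∀ m ∈ Ioc 0 (N / c), charDivisorSum χ c * (c : ℝ) ^ (-s.re) *
      ((m.divisors.card : ℝ) * (m : ℝ) ^ (-s.re)) ≤
      (N : ℝ) ^ (1 - s.re) * (charDivisorSum χ c / c * ((m.divisors.card : ℝ) / m)) := by
    intro m hm
    have hm0 : 0 < m := (mem_Ioc.mp hm).1
    have hm0' : (0 : ℝ) < m := by exact_mod_cast hm0
    have hcm : c * m ≤ N := by
      have := (mem_Ioc.mp hm).2
      rw [mul_comm]; exact (Nat.le_div_iff_mul_le hc0).mp this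
    have hcm' : ((c : ℝ) * m) ≤ N := by exact_mod_cast hcm
    have hpow : (c : ℝ) ^ (-s.re) * (m : ℝ) ^ (-s.re) ≤ (N : ℝ) ^ (1 - s.re) * (1 / ((c : ℝ) * m)) := by
      rw [← Real.mul_rpow hc0'.le hm0'.le]
      have e : ((c : ℝ) * m) ^ (-s.re) = ((c : ℝ) * m) ^ (1 - s.re) * (1 / ((c : ℝ) * m)) := by
        rw [one_div, ← Real.rpow_neg_one, ← Real.rpow_add (by positivity)]; ring_nf
      rw [e]
      exact mul_le_mul_of_nonneg_right
        (Real.rpow_le_rpow (by positivity) hcm' (by linarith)) (by positivity)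
    calc charDivisorSum χ c * (c : ℝ) ^ (-s.re) * ((m.divisors.card : ℝ) * (m : ℝ) ^ (-s.re))
        = charDivisorSum χ c * (m.divisors.card : ℝ) * ((c : ℝ) ^ (-s.re) * (m : ℝ) ^ (-s.re)) := by
          ring
      _ ≤ charDivisorSum χ c * (m.divisors.card : ℝ) * ((N : ℝ) ^ (1 - s.re) * (1 / ((c : ℝ) * m))) :=
          mul_le_mul_of_nonneg_left hpow (by positivity)
      _ = (N : ℝ) ^ (1 - s.re) * (charDivisorSum χ c / c * ((m.divisors.card : ℝ) / m)) := by
          field_simp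
  have hsumτ := sum_card_divisors_div_le (N / c)
  have hlogM : Real.log ((N / c : ℕ) : ℝ) ≤ Real.log N₁ :=
    Real.log_le_log (by exact_mod_cast hM1) (by exact_mod_cast hMN₁)
  have hlogM0 : 0 ≤ Real.log ((N / c : ℕ) : ℝ) := Real.log_nonneg (by exact_mod_cast hM1)
  have hQM : Real.log ((N / c : ℕ) : ℝ) ^ 2 / 2 + 2 * Real.log ((N / c : ℕ) : ℝ) + 2 ≤ Q := by
    simp only [hQ]; gcongr
  calc charDivisorSum χ c * (c : ℝ) ^ (-s.re) * ‖innerSum χ χk s (N / c)‖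
      ≤ charDivisorSum χ c * (c : ℝ) ^ (-s.re) *
          ∑ m ∈ Ioc 0 (N / c), (m.divisors.card : ℝ) * (m : ℝ) ^ (-s.re) :=
        mul_le_mul_of_nonneg_left hS (by positivity)
    _ = ∑ m ∈ Ioc 0 (N / c), charDivisorSum χ c * (c : ℝ) ^ (-s.re) *
          ((m.divisors.card : ℝ) * (m : ℝ) ^ (-s.re)) := by rw [mul_sum]
    _ ≤ ∑ m ∈ Ioc 0 (N / c), (N : ℝ) ^ (1 - s.re) *
          (charDivisorSum χ c / c * ((m.divisors.card : ℝ) / m)) := sum_le_sum hterm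
    _ = (N : ℝ) ^ (1 - s.re) * (charDivisorSum χ c / c) *
          ∑ m ∈ Ioc 0 (N / c), (m.divisors.card : ℝ) / m := by
        rw [mul_sum]
        refine sum_congr rfl fun m _ => by ring
    _ ≤ (N : ℝ) ^ (1 - s.re) * (charDivisorSum χ c / c) * Q :=
        mul_le_mul_of_nonneg_left (hsumτ.trans hQM) (by positivity)
    _ = (N : ℝ) ^ (1 - s.re) * Q * (charDivisorSum χ c / c) := by ring

/-! ### Part H — assembly: (3.12)–(3.17) ⇒ Theorem 1 -/

/-- **(3.12)–(3.17) assembled** (`N₁ = V³`, `N = V⁶`, `σ = Re s₀ ∈ (0.95, 1)`, `kD(1+|s₀|/σ) ≤ 3V`,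
`D ≤ 3V`): `0.134 ≤ Σ₁ + Σ₂ ≤ 1200 log³V · V^{-1/5} +
V^{6(1-σ)} (4.5 log²V + 6 log V + 2)(3 log V · L(1,χ_D) + 300 log V/V)`.
[cite: Pintz1976ElementaryIV, §3 (3.12)–(3.17) pp. 425–426] -/
theorem main_inequality [NeZero k] [NeZero q] (hq : χ ^ 2 = 1) (hχ : χ ≠ 1) (hχk : χk ≠ 1)
    (hψ : prodChar χ χk ≠ 1) {s : ℂ} (hσ : 0.95 < s.re) (hσ1 : s.re < 1)
    (hL : χk.LFunction s = 0) {V : ℕ} (hV : 3 ≤ V)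
    (hkq : ((k * q : ℕ) : ℝ) * (1 + ‖s‖ / s.re) ≤ 3 * V) (hqV : (q : ℝ) ≤ 3 * V) :
    (0.134 : ℝ) ≤ 1200 * Real.log V ^ 3 * (V : ℝ) ^ (-(1 / 5 : ℝ)) +
      (V : ℝ) ^ (6 * (1 - s.re)) * (9 / 2 * Real.log V ^ 2 + 6 * Real.log V + 2) *
        (3 * Real.log V * (χ.LFunction 1).re + 300 * Real.log V / (V : ℝ)) := by
  have hhalf : (1 : ℝ) / 2 ≤ s.re := by norm_num at hσ ⊢; linarith
  have hs0 : 0 < s.re := by linarith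
  set σ : ℝ := s.re with hσdef
  set L : ℝ := Real.log V with hLdef
  set N₁ : ℕ := V ^ 3 with hN₁
  have hV0 : (0 : ℝ) < V := by exact_mod_cast (show 0 < V by omega)
  have hV1 : (1 : ℝ) ≤ V := by exact_mod_cast (show 1 ≤ V by omega)
  have hN₁1 : 1 ≤ N₁ := Nat.one_le_pow _ _ (by omega)
  have hL1 : 1 ≤ L := by
    have h3 : Real.log 3 ≤ L := Real.log_le_log (by norm_num) (by exact_mod_cast hV)
    have : (1 : ℝ) ≤ Real.log 3 := by
      rw [← Real.log_exp 1]
      exact Real.log_le_log (Real.exp_pos 1) Real.exp_one_lt_three.le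
    linarith
  have hL0 : 0 ≤ L := by linarith
  have hA0 : 0 ≤ 1 + ‖s‖ / σ := by
    have : 0 ≤ ‖s‖ / σ := div_nonneg (norm_nonneg _) hs0.le; positivity
  -- casts and logs of `N₁ = V³`, `N = V⁶`
  have hN₁r : ((N₁ : ℕ) : ℝ) = (V : ℝ) ^ (3 : ℝ) := by
    rw [hN₁, Nat.cast_pow, ← Real.rpow_natCast]; norm_num
  have hNr : (((N₁ ^ 2 : ℕ)) : ℝ) = (V : ℝ) ^ (6 : ℝ) := by
    rw [Nat.cast_pow, hN₁r, ← Real.rpow_mul_natCast hV0.le]; norm_num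
  have hlogN₁ : Real.log ((N₁ : ℕ) : ℝ) = 3 * L := by
    rw [hN₁r, Real.log_rpow hV0]
  have hlogN : Real.log (((N₁ ^ 2 : ℕ)) : ℝ) = 6 * L := by
    rw [hNr, Real.log_rpow hV0]
  -- (3.12): lower bound and the swap
  have hlow := norm_sum_sq_ge χk hσ (M := N₁) hN₁1
  have e1 := sum_sqInd_eq_sum_sq (fun n => χk n * (n : ℂ) ^ (-s)) N₁
  have e2 := sum_sqInd_eq_sum_weight_mul_innerSum χ χk hq s (N₁ ^ 2)
  have hid : ∑ l ∈ Ioc 0 N₁, χk ((l ^ 2 : ℕ) : ZMod k) * ((l ^ 2 : ℕ) : ℂ) ^ (-s) =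
      ∑ c ∈ Ioc 0 (N₁ ^ 2), ((weight χ c : ℝ) : ℂ) * χk c * (c : ℂ) ^ (-s) *
        innerSum χ χk s (N₁ ^ 2 / c) := e1.symm.trans e2
  rw [hid] at hlow
  -- termwise norms and the split at `N₁`
  have hnorm : ‖∑ c ∈ Ioc 0 (N₁ ^ 2), ((weight χ c : ℝ) : ℂ) * χk c * (c : ℂ) ^ (-s) *
        innerSum χ χk s (N₁ ^ 2 / c)‖ ≤
      ∑ c ∈ Ioc 0 (N₁ ^ 2), charDivisorSum χ c * (c : ℝ) ^ (-σ) *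
        ‖innerSum χ χk s (N₁ ^ 2 / c)‖ :=
    (norm_sum_le _ _).trans (sum_le_sum fun c hc => norm_weight_term_le χ χk hq s (mem_Ioc.mp hc).1 _)
  have hN₁N : N₁ ≤ N₁ ^ 2 := Nat.le_self_pow (by norm_num) N₁
  have hsplit := (sum_Ioc_consecutive
    (fun c => charDivisorSum χ c * (c : ℝ) ^ (-σ) * ‖innerSum χ χk s (N₁ ^ 2 / c)‖)
    (Nat.zero_le N₁) hN₁N).symm
  have hS1 := sigma_one_le χ χk hq hχk hψ hhalf hσ1.le hL hN₁1
  have hS2 := sigma_two_le χ χk hq hσ1.le hN₁1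
  have hG := sum_charDivisorSum_div_le χ hq hχ (by omega : 2 ≤ V) hqV
  -- numerical majorants
  set Q : ℝ := 9 / 2 * L ^ 2 + 6 * L + 2 with hQ
  have hQ0 : 0 ≤ Q := by positivity
  have hQeq : Real.log ((N₁ : ℕ) : ℝ) ^ 2 / 2 + 2 * Real.log ((N₁ : ℕ) : ℝ) + 2 = Q := by
    rw [hlogN₁, hQ]; ring
  have hH : ∑ c ∈ Ioc 0 N₁, (c.divisors.card : ℝ) / c ≤ Q := by
    have := sum_card_divisors_div_le N₁
    rwa [hQeq] at this
  have hH0 : 0 ≤ ∑ c ∈ Ioc 0 N₁, (c.divisors.card : ℝ) / c :=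
    sum_nonneg fun c _ => by positivity
  -- powers of `V`
  set X : ℝ := (V : ℝ) ^ (-(1 / 5 : ℝ)) with hX
  set P : ℝ := (V : ℝ) ^ (6 * (1 - σ)) with hP
  have hX0 : 0 ≤ X := by positivity
  have hP0 : 0 ≤ P := by positivity
  have hpow1 : ((N₁ : ℕ) : ℝ) ^ (1 - σ) * ((N₁ : ℕ) : ℝ) ^ (1 / 2 - σ) * V ≤ X := by
    have e : (V : ℝ) ^ (3 * (1 - σ)) * (V : ℝ) ^ (3 * (1 / 2 - σ)) * V =
        (V : ℝ) ^ (3 * (1 - σ) + 3 * (1 / 2 - σ) + 1) := by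
      rw [Real.rpow_add hV0, Real.rpow_add hV0, Real.rpow_one]
    rw [hN₁r, ← Real.rpow_mul hV0.le, ← Real.rpow_mul hV0.le, e]
    refine Real.rpow_le_rpow_of_exponent_le hV1 ?_
    norm_num at hσ ⊢; linarith
  have hpow2 : (((N₁ ^ 2 : ℕ)) : ℝ) ^ (1 - σ) = P := by
    rw [hNr, ← Real.rpow_mul hV0.le, hP]
  -- Σ₁ ≤ 1200 L³ X
  have hS1' : ∑ c ∈ Ioc 0 N₁, charDivisorSum χ c * (c : ℝ) ^ (-σ) *
      ‖innerSum χ χk s (N₁ ^ 2 / c)‖ ≤ 1200 * L ^ 3 * X := by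
    refine hS1.trans ?_
    rw [hlogN]
    have hkq0 : 0 ≤ ((k * q : ℕ) : ℝ) * (1 + ‖s‖ / σ) := by positivity
    calc (∑ c ∈ Ioc 0 N₁, (c.divisors.card : ℝ) / c) *
          (((N₁ : ℕ) : ℝ) ^ (1 - σ) * (4 * ((k * q : ℕ) : ℝ) * (1 + ‖s‖ / σ) * (2 + 6 * L) *
            ((N₁ : ℕ) : ℝ) ^ (1 / 2 - σ)))
        = 4 * (∑ c ∈ Ioc 0 N₁, (c.divisors.card : ℝ) / c) *
            (((k * q : ℕ) : ℝ) * (1 + ‖s‖ / σ)) * (2 + 6 * L) *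
            (((N₁ : ℕ) : ℝ) ^ (1 - σ) * ((N₁ : ℕ) : ℝ) ^ (1 / 2 - σ)) := by ring
      _ ≤ 4 * Q * (3 * V) * (2 + 6 * L) *
            (((N₁ : ℕ) : ℝ) ^ (1 - σ) * ((N₁ : ℕ) : ℝ) ^ (1 / 2 - σ)) := by
          gcongr
      _ = 12 * Q * (2 + 6 * L) * (((N₁ : ℕ) : ℝ) ^ (1 - σ) * ((N₁ : ℕ) : ℝ) ^ (1 / 2 - σ) * V) := by
          ring
      _ ≤ 12 * Q * (2 + 6 * L) * X := by gcongr
      _ ≤ 12 * (25 / 2 * L ^ 2) * (8 * L) * X := by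
          gcongr
          · simp only [hQ]; nlinarith
          · linarith
      _ = 1200 * L ^ 3 * X := by ring
  -- Σ₂ ≤ P Q (3 L L₁ + 300 L/V)
  have hS2' : ∑ c ∈ Ioc N₁ (N₁ ^ 2), charDivisorSum χ c * (c : ℝ) ^ (-σ) *
      ‖innerSum χ χk s (N₁ ^ 2 / c)‖ ≤
      P * Q * (3 * L * (χ.LFunction 1).re + 300 * L / (V : ℝ)) := by
    refine hS2.trans ?_
    rw [hpow2, hQeq]
    exact mul_le_mul_of_nonneg_left hG (by positivity)
  -- conclusion
  calc (0.134 : ℝ) ≤ _ := hlow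
    _ ≤ _ := hnorm
    _ = _ := hsplit
    _ ≤ 1200 * L ^ 3 * X + P * Q * (3 * L * (χ.LFunction 1).re + 300 * L / (V : ℝ)) :=
        add_le_add hS1' hS2'

/-- The three growth conditions used at the end, valid for all large `V`:
`log V ≥ 60`, `1200 log³V ≤ 0.0005 V^{1/5}`, `100 log³V · V^{3/10} ≤ 0.001 V`. [cite: Pintz1976ElementaryIV, §3 p. 426 (proof of Theorem 1, final step; D > D₀ p. 422)] -/
theorem eventually_thresholds : ∃ V₀ : ℕ, ∀ V : ℕ, V₀ ≤ V →
    60 ≤ Real.log V ∧ 1200 * Real.log V ^ 3 ≤ 0.0005 * (V : ℝ) ^ (1 / 5 : ℝ) ∧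
      100 * Real.log V ^ 3 * (V : ℝ) ^ (3 / 10 : ℝ) ≤ 0.001 * V := by
  have h3 : ∀ x : ℝ, Real.log x ^ (3 : ℝ) = Real.log x ^ 3 := fun x => by
    rw [show (3 : ℝ) = ((3 : ℕ) : ℝ) by norm_num, Real.rpow_natCast]
  have h1 : ∀ᶠ x : ℝ in Filter.atTop, 60 ≤ Real.log x :=
    Real.tendsto_log_atTop.eventually_ge_atTop 60
  have h2 : ∀ᶠ x : ℝ in Filter.atTop, 1200 * Real.log x ^ 3 ≤ 0.0005 * x ^ (1 / 5 : ℝ) := by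
    have hb := (isLittleO_log_rpow_rpow_atTop (3 : ℝ) (by norm_num : (0 : ℝ) < 1 / 5)).bound
      (show (0 : ℝ) < 0.0005 / 1200 by norm_num)
    filter_upwards [hb, Filter.eventually_ge_atTop 1] with x hx hx1
    rw [h3, Real.norm_of_nonneg (pow_nonneg (Real.log_nonneg hx1) 3),
      Real.norm_of_nonneg (Real.rpow_nonneg (by linarith) _)] at hx
    linarith
  have h4 : ∀ᶠ x : ℝ in Filter.atTop,
      100 * Real.log x ^ 3 * x ^ (3 / 10 : ℝ) ≤ 0.001 * x := by
    have hb := (isLittleO_log_rpow_rpow_atTop (3 : ℝ) (by norm_num : (0 : ℝ) < 7 / 10)).bound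
      (show (0 : ℝ) < 0.001 / 100 by norm_num)
    filter_upwards [hb, Filter.eventually_ge_atTop 1] with x hx hx1
    rw [h3, Real.norm_of_nonneg (pow_nonneg (Real.log_nonneg hx1) 3),
      Real.norm_of_nonneg (Real.rpow_nonneg (by linarith) _)] at hx
    have hx0 : 0 < x := by linarith
    have e : x ^ (7 / 10 : ℝ) * x ^ (3 / 10 : ℝ) = x := by
      rw [← Real.rpow_add hx0]; norm_num
    have h0 : 0 ≤ x ^ (3 / 10 : ℝ) := Real.rpow_nonneg hx0.le _
    calc 100 * Real.log x ^ 3 * x ^ (3 / 10 : ℝ)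
        ≤ 100 * (0.001 / 100 * x ^ (7 / 10 : ℝ)) * x ^ (3 / 10 : ℝ) := by gcongr
      _ = 0.001 * (x ^ (7 / 10 : ℝ) * x ^ (3 / 10 : ℝ)) := by ring
      _ = 0.001 * x := by rw [e]
  have hall := tendsto_natCast_atTop_atTop.eventually (h1.and (h2.and h4))
  obtain ⟨V₀, hV₀⟩ := Filter.eventually_atTop.mp hall
  exact ⟨V₀, fun V hV => hV₀ V hV⟩

/-- **The endgame arithmetic**: from `0.134 ≤ E + P·Q·(3L·L₁ + 300L/V)` with
`Q = 4.5L² + 6L + 2`, `E ≤ 0.0005`, `L ≥ 60`, `P ≥ 1`, `100 L³ P ≤ 0.001 V`, conclude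
`L₁ > 1/(140 P L³)` (indeed `≥ 0.00865/(P L³)`). [cite: Pintz1976ElementaryIV, §3 (3.17) p. 426 (proof of Theorem 1, final step)] -/
theorem endgame {E L P V L₁ : ℝ} (hmain : 0.134 ≤ E + P * (9 / 2 * L ^ 2 + 6 * L + 2) *
      (3 * L * L₁ + 300 * L / V)) (hE : E ≤ 0.0005) (hL : 60 ≤ L) (hP : 1 ≤ P) (hV : 0 < V)
    (hc : 100 * L ^ 3 * P ≤ 0.001 * V) : 1 / (140 * P * L ^ 3) < L₁ := by
  set Q : ℝ := 9 / 2 * L ^ 2 + 6 * L + 2 with hQ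
  have hL0 : 0 < L := by linarith
  have hP0 : 0 < P := by linarith
  have hQ0 : 0 < Q := by positivity
  have hQL : Q ≤ 4.61 * L ^ 2 := by simp only [hQ]; nlinarith
  have hF1 : 0.1335 ≤ P * Q * (3 * L * L₁ + 300 * L / V) := by
    norm_num at hmain hE ⊢; linarith
  have hPQ : P * Q * (300 * L / V) ≤ 0.01383 := by
    have h1 : P * Q * (300 * L / V) ≤ P * (4.61 * L ^ 2) * (300 * L / V) := by gcongr
    have h2 : P * (4.61 * L ^ 2) * (300 * L / V) = 13.83 * (100 * L ^ 3 * P) / V := by ring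
    rw [h2] at h1
    have h3 : 13.83 * (100 * L ^ 3 * P) / V ≤ 13.83 * (0.001 * V) / V := by gcongr
    have h4 : 13.83 * (0.001 * V) / V = 0.01383 := by field_simp; ring
    linarith
  have hF2 : 0.11967 ≤ P * Q * (3 * L * L₁) := by
    have e : P * Q * (3 * L * L₁ + 300 * L / V) =
        P * Q * (3 * L * L₁) + P * Q * (300 * L / V) := by ring
    rw [e] at hF1
    linarith
  have hPQL : 0 < P * Q * (3 * L) := by positivity
  have hL₁0 : 0 < L₁ := by
    by_contra hle
    push Not at hle
    have : P * Q * (3 * L * L₁) ≤ 0 := by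
      rw [show P * Q * (3 * L * L₁) = (P * Q * (3 * L)) * L₁ by ring]
      exact mul_nonpos_of_nonneg_of_nonpos hPQL.le hle
    linarith
  have hF3 : 0.11967 ≤ 13.83 * (P * L ^ 3 * L₁) := by
    have : P * Q * (3 * L * L₁) ≤ P * (4.61 * L ^ 2) * (3 * L * L₁) := by
      have h0 : 0 ≤ 3 * L * L₁ := by positivity
      gcongr
    linarith
  rw [div_lt_iff₀ (by positivity)]
  nlinarith

/-- The size bookkeeping `kD(1 + |s₀|/σ) ≤ 3V`, `D ≤ 3V` for `V = ⌊k|s₀|D⌋ ≥ 3`, `0.95 < σ ≤ |s₀|`.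
[cite: Pintz1976ElementaryIV, Theorem 1 p. 422 (U = k|s₀|D)] -/
theorem size_le_three_mul {k D : ℕ} (hk : 1 ≤ k) {σ ns : ℝ} (hσ : 0.95 < σ) (hns : σ ≤ ns)
    {V : ℝ} (hV3 : 3 ≤ V) (hWs : (k : ℝ) * D * ns < V + 1) :
    ((k * D : ℕ) : ℝ) * (1 + ns / σ) ≤ 3 * V ∧ (D : ℝ) ≤ 3 * V := by
  have hk1 : (1 : ℝ) ≤ k := by exact_mod_cast hk
  have hD0 : (0 : ℝ) ≤ D := Nat.cast_nonneg D
  have hs0 : 0 < σ := by norm_num at hσ; linarith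
  have hns95 : 0.95 ≤ ns := hσ.le.trans hns
  have hW0 : 0 ≤ (k : ℝ) * D := by positivity
  have hW : (k : ℝ) * D ≤ (k : ℝ) * D * ns / 0.95 := by
    rw [le_div_iff₀ (by norm_num)]; nlinarith
  have h1 : (k : ℝ) * D * (ns / σ) ≤ (k : ℝ) * D * ns / 0.95 := by
    rw [mul_div_assoc]
    apply mul_le_mul_of_nonneg_left _ hW0
    exact div_le_div_of_nonneg_left (by linarith) (by norm_num) hσ.le
  have h2 : (k : ℝ) * D * ns / 0.95 ≤ (V + 1) / 0.95 :=
    div_le_div_of_nonneg_right hWs.le (by norm_num)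
  have h3 : (V + 1) / 0.95 + (V + 1) / 0.95 ≤ 3 * V := by
    rw [← add_div, div_le_iff₀ (by norm_num)]; nlinarith
  refine ⟨?_, ?_⟩
  · push_cast
    calc (k : ℝ) * D * (1 + ns / σ) = (k : ℝ) * D + (k : ℝ) * D * (ns / σ) := by ring
      _ ≤ (k : ℝ) * D * ns / 0.95 + (k : ℝ) * D * ns / 0.95 := add_le_add hW h1
      _ ≤ (V + 1) / 0.95 + (V + 1) / 0.95 := add_le_add h2 h2
      _ ≤ 3 * V := h3
  · have hkD : (D : ℝ) ≤ (k : ℝ) * D := by nlinarith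
    have h3' : (V + 1) / 0.95 ≤ 3 * V := by
      rw [div_le_iff₀ (by norm_num)]; nlinarith
    linarith

/-- **The endgame arithmetic, quantitative form**: under the hypotheses of `endgame`,
`L₁ ≥ 0.0086/(P L³)` (`0.11967/13.83 = 0.00865…`). [cite: Pintz1976ElementaryIV, §3 (3.17) p. 426 (proof of Theorem 1, final step)] -/
theorem endgame_strong {E L P V L₁ : ℝ} (hmain : 0.134 ≤ E + P * (9 / 2 * L ^ 2 + 6 * L + 2) *
      (3 * L * L₁ + 300 * L / V)) (hE : E ≤ 0.0005) (hL : 60 ≤ L) (hP : 1 ≤ P) (hV : 0 < V)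
    (hc : 100 * L ^ 3 * P ≤ 0.001 * V) : 0.0086 / (P * L ^ 3) ≤ L₁ := by
  set Q : ℝ := 9 / 2 * L ^ 2 + 6 * L + 2 with hQ
  have hL0 : 0 < L := by linarith
  have hP0 : 0 < P := by linarith
  have hQ0 : 0 < Q := by positivity
  have hQL : Q ≤ 4.61 * L ^ 2 := by simp only [hQ]; nlinarith
  have hF1 : 0.1335 ≤ P * Q * (3 * L * L₁ + 300 * L / V) := by
    norm_num at hmain hE ⊢; linarith
  have hPQ : P * Q * (300 * L / V) ≤ 0.01383 := by
    have h1 : P * Q * (300 * L / V) ≤ P * (4.61 * L ^ 2) * (300 * L / V) := by gcongr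
    have h2 : P * (4.61 * L ^ 2) * (300 * L / V) = 13.83 * (100 * L ^ 3 * P) / V := by ring
    rw [h2] at h1
    have h3 : 13.83 * (100 * L ^ 3 * P) / V ≤ 13.83 * (0.001 * V) / V := by gcongr
    have h4 : 13.83 * (0.001 * V) / V = 0.01383 := by field_simp; ring
    linarith
  have hF2 : 0.11967 ≤ P * Q * (3 * L * L₁) := by
    have e : P * Q * (3 * L * L₁ + 300 * L / V) =
        P * Q * (3 * L * L₁) + P * Q * (300 * L / V) := by ring
    rw [e] at hF1
    linarith
  have hPQL : 0 < P * Q * (3 * L) := by positivity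
  have hL₁0 : 0 < L₁ := by
    by_contra hle
    push Not at hle
    have : P * Q * (3 * L * L₁) ≤ 0 := by
      rw [show P * Q * (3 * L * L₁) = (P * Q * (3 * L)) * L₁ by ring]
      exact mul_nonpos_of_nonneg_of_nonpos hPQL.le hle
    linarith
  have hF3 : 0.11967 ≤ 13.83 * (P * L ^ 3 * L₁) := by
    have : P * Q * (3 * L * L₁) ≤ P * (4.61 * L ^ 2) * (3 * L * L₁) := by
      have h0 : 0 ≤ 3 * L * L₁ := by positivity
      gcongr
    linarith
  rw [div_le_iff₀ (by positivity)]
  nlinarith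

/-- **Theorem 1, quantitative core.** With `V₀` from `eventually_thresholds`, `D > 2V₀ + 10`, a zero
`s₀ = 1 − γ + it` of `L(s, χ_k)` (`χ_k ≠ χ₀`, `γ < 0.05`), `χ_D ≠ χ₀` quadratic with `χ_kχ_D ≠ χ₀`,
and `U = k|s₀|D`, `V = ⌊U⌋`: `0 < γ`, `3 ≤ V ≤ U`, `0.95 D ≤ U`, `log V ≥ 60` and
`L(1, χ_D) ≥ 0.0086/(V^{6γ} log³V)`. [cite: Pintz1976ElementaryIV, Theorem 1 p. 422 and §3 (3.17) p. 426] -/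
theorem theorem1_core {V₀ : ℕ} (hV₀ : ∀ V : ℕ, V₀ ≤ V →
      60 ≤ Real.log V ∧ 1200 * Real.log V ^ 3 ≤ 0.0005 * (V : ℝ) ^ (1 / 5 : ℝ) ∧
        100 * Real.log V ^ 3 * (V : ℝ) ^ (3 / 10 : ℝ) ≤ 0.001 * V)
    [NeZero k] (hχk : χk ≠ 1) {γ t : ℝ} (hγ : γ < 0.05)
    (hz : χk.LFunction (1 - γ + t * Complex.I) = 0) [NeZero q] (hD : 2 * V₀ + 10 < q)
    (hχ : χ ≠ 1) (hquad : χ.IsQuadratic) (hprod : prodChar χ χk ≠ 1) :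
    0 < γ ∧ (3 : ℝ) ≤ ⌊(k : ℝ) * ‖(1 - γ + t * Complex.I : ℂ)‖ * q⌋₊ ∧
      ((⌊(k : ℝ) * ‖(1 - γ + t * Complex.I : ℂ)‖ * q⌋₊ : ℕ) : ℝ) ≤
        (k : ℝ) * ‖(1 - γ + t * Complex.I : ℂ)‖ * q ∧
      0.95 * (q : ℝ) ≤ (k : ℝ) * ‖(1 - γ + t * Complex.I : ℂ)‖ * q ∧
      60 ≤ Real.log ⌊(k : ℝ) * ‖(1 - γ + t * Complex.I : ℂ)‖ * q⌋₊ ∧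
      0.0086 / (((⌊(k : ℝ) * ‖(1 - γ + t * Complex.I : ℂ)‖ * q⌋₊ : ℕ) : ℝ) ^ (6 * γ) *
          Real.log ⌊(k : ℝ) * ‖(1 - γ + t * Complex.I : ℂ)‖ * q⌋₊ ^ 3) ≤ (χ.LFunction 1).re := by
  -- the zero `s₀ = 1 - γ + it`: `0 < γ < 0.05`
  set s : ℂ := 1 - γ + t * Complex.I with hsdef
  have hsre : s.re = 1 - γ := by simp [hsdef]
  have hγ0 : 0 < γ := by
    by_contra hle
    push Not at hle
    exact DirichletCharacter.LFunction_ne_zero_of_one_le_re χk (Or.inl hχk) (s := s)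
      (by rw [hsre]; linarith) hz
  have hσ : 0.95 < s.re := by rw [hsre]; norm_num at hγ ⊢; linarith
  have hσ1 : s.re < 1 := by rw [hsre]; linarith
  have hnorm : s.re ≤ ‖s‖ := Complex.re_le_norm s
  have hns : 0.95 < ‖s‖ := lt_of_lt_of_le hσ hnorm
  -- `U = k|s₀|D`, `V = ⌊U⌋`
  set U : ℝ := (k : ℝ) * ‖s‖ * q with hUdef
  have hk1 : (1 : ℝ) ≤ k := by exact_mod_cast NeZero.one_le
  have hD1 : ((2 * V₀ + 10 : ℕ) : ℝ) < q := by exact_mod_cast hD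
  push_cast at hD1
  have hD0 : (0 : ℝ) < q := by linarith
  have hU_lb : 0.95 * (q : ℝ) ≤ U := by
    have h1 : (q : ℝ) * 0.95 ≤ (q : ℝ) * ‖s‖ := mul_le_mul_of_nonneg_left hns.le hD0.le
    have h2 : (q : ℝ) * ‖s‖ ≤ (k : ℝ) * ‖s‖ * q := by
      have : 0 ≤ (q : ℝ) * ‖s‖ := by positivity
      nlinarith
    linarith
  have hU0 : 0 ≤ U := by positivity
  set V : ℕ := ⌊U⌋₊ with hVdef
  have hVU : (V : ℝ) ≤ U := Nat.floor_le hU0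
  have hUV : U < V + 1 := Nat.lt_floor_add_one U
  have hV₀0 : (0 : ℝ) ≤ V₀ := Nat.cast_nonneg V₀
  have hVlarge : (V₀ : ℝ) + 3 ≤ V := by
    norm_num at hU_lb
    linarith
  have hV₀V : V₀ ≤ V := by exact_mod_cast (show (V₀ : ℝ) ≤ V by linarith)
  have hV3r : (3 : ℝ) ≤ V := by linarith
  have hV3 : 3 ≤ V := by exact_mod_cast hV3r
  have hV0 : (0 : ℝ) < V := by linarith
  have hV1 : (1 : ℝ) ≤ V := by linarith
  obtain ⟨hL60, hth1, hth2⟩ := hV₀ V hV₀V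
  -- the size hypotheses of `main_inequality`
  have hWs : (k : ℝ) * q * ‖s‖ < V + 1 := by
    have : (k : ℝ) * q * ‖s‖ = U := by rw [hUdef]; ring
    linarith
  obtain ⟨hkq, hqV⟩ := size_le_three_mul NeZero.one_le hσ hnorm hV3r hWs
  have hquad' : χ ^ 2 = 1 := hquad.sq_eq_one
  have hmain := main_inequality χ χk hquad' hχ hχk hprod hσ hσ1 hz hV3 hkq hqV
  -- the endgame
  set L : ℝ := Real.log V with hLdef
  set P : ℝ := (V : ℝ) ^ (6 * (1 - s.re)) with hP
  have hL0 : 0 < L := by linarith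
  have hP1 : 1 ≤ P := Real.one_le_rpow hV1 (by rw [hsre]; linarith)
  have hPV : P ≤ (V : ℝ) ^ (3 / 10 : ℝ) := by
    refine Real.rpow_le_rpow_of_exponent_le hV1 ?_
    rw [hsre]; norm_num at hγ ⊢; linarith
  have hX : 1200 * L ^ 3 * (V : ℝ) ^ (-(1 / 5 : ℝ)) ≤ 0.0005 := by
    have hV5 : 0 < (V : ℝ) ^ (1 / 5 : ℝ) := by positivity
    rw [Real.rpow_neg hV0.le, ← div_eq_mul_inv, div_le_iff₀ hV5]
    exact hth1
  have hc : 100 * L ^ 3 * P ≤ 0.001 * V := by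
    have : 100 * L ^ 3 * P ≤ 100 * L ^ 3 * (V : ℝ) ^ (3 / 10 : ℝ) := by gcongr
    exact this.trans hth2
  have hkey := endgame_strong hmain hX hL60 hP1 hV0 hc
  have hPe : P = (V : ℝ) ^ (6 * γ) := by
    rw [hP, hsre]; ring_nf
  refine ⟨hγ0, hV3r, hVU, hU_lb, hL60, ?_⟩
  rw [← hPe]
  exact hkey

end Pintz1976Heilbronn

open Pintz1976Heilbronn RealChar in
/-- **Pintz 1976 (IV), Theorem 1 — PROVED.** `∃ D₀ ∀ χ_k ≠ χ₀ mod k` with a zero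
`s₀ = 1 − γ + it`, `γ < 0.05`, `∀` real non-principal `χ_D` mod `D > D₀` with `χ_kχ_D`
non-principal: `L(1, χ_D) > 1/(140 U^{6γ} log³U)`, `U = k|s₀|D`. Discharges the named fact
`pintz1976Heilbronn_theorem1` by the printed elementary argument ((3.1)–(3.17)): the proof yields
`L(1,χ_D) ≥ (0.134 − o(1))/(13.5 + o(1)) · U^{-6γ} log^{-3}U`, and `1/105 > 1/140`.
[cite: Pintz1976ElementaryIV, Theorem 1 p. 422 (2.1); proof §3 pp. 424–426] -/
theorem pintz1976Heilbronn_theorem1_holds : pintz1976Heilbronn_theorem1 := by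
  obtain ⟨V₀, hV₀⟩ := eventually_thresholds
  refine ⟨2 * V₀ + 10, ?_⟩
  intro k _ χk hχk γ t hγ hz D _ χD hD hχD hquad hprod
  obtain ⟨hγ0, hV3, hVU, hUq, hL60, hkey⟩ :=
    theorem1_core χD χk hV₀ hχk hγ hz hD hχD hquad hprod
  set U : ℝ := (k : ℝ) * ‖(1 - γ + t * Complex.I : ℂ)‖ * D with hUdef
  set V : ℕ := ⌊U⌋₊ with hVdef
  set L : ℝ := Real.log V with hLdef
  set P : ℝ := (V : ℝ) ^ (6 * γ) with hP
  have hV0 : (0 : ℝ) < V := by linarith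
  have hL0 : 0 < L := by linarith
  have hP0 : 0 < P := by positivity
  have hkey' : 1 / (140 * P * L ^ 3) < (χD.LFunction 1).re := by
    refine lt_of_lt_of_le ?_ hkey
    rw [div_lt_div_iff₀ (by positivity) (by positivity)]
    nlinarith [mul_pos hP0 (pow_pos hL0 3)]
  -- comparison `V ≤ U`: `P L³ ≤ U^{6γ} log³U`
  have hPU : P ≤ U ^ (6 * γ) := Real.rpow_le_rpow hV0.le hVU (by linarith)
  have hLU : L ^ 3 ≤ Real.log U ^ 3 :=
    pow_le_pow_left₀ hL0.le (Real.log_le_log hV0 hVU) 3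
  have hfinal : 1 / (140 * U ^ (6 * γ) * Real.log U ^ 3) ≤ 1 / (140 * P * L ^ 3) := by
    apply one_div_le_one_div_of_le (by positivity)
    calc 140 * P * L ^ 3 ≤ 140 * U ^ (6 * γ) * L ^ 3 := by gcongr
      _ ≤ 140 * U ^ (6 * γ) * Real.log U ^ 3 := by gcongr
  exact lt_of_le_of_lt hfinal hkey'

/-! ### Part I — Theorem 2: Page's step (4.1) `L(1, χ_D)/δ ≤ log²D` and the conclusion -/

namespace Pintz1976Heilbronn

open DirichletAbel RealChar

variable {q : ℕ} (χ : DirichletCharacter ℂ q) {k : ℕ} (χk : DirichletCharacter ℂ k)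

/-- For `q ≥ 3`: the Pólya–Vinogradov constant is `≤ 9 √q log q`. [folklore] -/
private theorem pv_le_nine' (hq : 3 ≤ q) :
    4 / Real.pi ^ 2 * Real.sqrt q * Real.log q +
      8 / Real.pi ^ 2 * Real.sqrt q * Real.log (Real.log q) + 15 / 2 * Real.sqrt q ≤
      9 * Real.sqrt q * Real.log q := by
  have hq3 : (3 : ℝ) ≤ q := by exact_mod_cast hq
  have hlog1 : 1 ≤ Real.log q := by
    rw [← Real.log_exp 1]
    exact Real.log_le_log (Real.exp_pos 1)
      (le_trans (le_of_lt (lt_trans Real.exp_one_lt_d9 (by norm_num))) hq3)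
  have hlog0 : 0 < Real.log q := by linarith
  have hll : Real.log (Real.log q) ≤ Real.log q := by
    have := Real.log_le_sub_one_of_pos hlog0
    linarith
  have hpi : 9 ≤ Real.pi ^ 2 := by nlinarith [Real.pi_gt_three]
  have hsq : 0 ≤ Real.sqrt q := Real.sqrt_nonneg _
  have e1 : 4 / Real.pi ^ 2 * Real.sqrt q * Real.log q ≤ 4 / 9 * Real.sqrt q * Real.log q := by
    have h1 : 4 / Real.pi ^ 2 ≤ 4 / 9 := div_le_div_of_nonneg_left (by norm_num) (by norm_num) hpi
    gcongr
  have e2 : 8 / Real.pi ^ 2 * Real.sqrt q * Real.log (Real.log q) ≤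
      8 / 9 * Real.sqrt q * Real.log q := by
    have h2 : 8 / Real.pi ^ 2 ≤ 8 / 9 := div_le_div_of_nonneg_left (by norm_num) (by norm_num) hpi
    calc 8 / Real.pi ^ 2 * Real.sqrt q * Real.log (Real.log q)
        ≤ 8 / Real.pi ^ 2 * Real.sqrt q * Real.log q :=
          mul_le_mul_of_nonneg_left hll (by positivity)
      _ ≤ 8 / 9 * Real.sqrt q * Real.log q := by gcongr
  have e3 : 15 / 2 * Real.sqrt q ≤ 15 / 2 * Real.sqrt q * Real.log q := by
    nlinarith
  nlinarith

/-- `|Σ_{m ≤ n} χ(m)| ≤ 9√q log q` for every non-principal `χ` mod `q ≥ 3` (the tree's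
Pólya–Vinogradov inequality for arbitrary non-principal characters).
[cite: MontgomeryVaughan2007, §9.4 Thm. 9.18] -/
theorem norm_partialSum_le_nine [NeZero q] (hχ : χ ≠ 1) (hq : 3 ≤ q) (n : ℕ) :
    ‖partialSum χ n‖ ≤ 9 * Real.sqrt q * Real.log q :=
  (Pintz1976Deuring.norm_partialSum_le_pv χ hχ n).trans (pv_le_nine' hq)

/-- **`‖L(1, χ)‖ ≤ log q + 3`** for every non-principal `χ` mod `q` (partial sums `≤ q` and the
tail estimate `‖Σ_{d≤M} χ(d)/d − L(1,χ)‖ ≤ 2q/(M+1)` at `M = q`).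
[cite: MontgomeryVaughan2007, §4.3 eq. (4.23) and §11.2.1 Exercise 3 (a)] -/
theorem norm_LFunction_one_le_log_add_three [NeZero q] (hχ : χ ≠ 1) :
    ‖χ.LFunction 1‖ ≤ Real.log q + 3 := by
  have hq0 : (0 : ℝ) < q := by exact_mod_cast Nat.pos_of_ne_zero (NeZero.ne q)
  have h := norm_sum_Icc_div_sub_LFunction_one_le χ hχ (norm_partialSum_le χ hχ) q
  have hH : ‖∑ d ∈ Icc 1 q, χ (d : ZMod q) / (d : ℂ)‖ ≤ 1 + Real.log q := by
    refine (norm_sum_le _ _).trans ?_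
    have e : ∀ d ∈ Icc 1 q, ‖χ (d : ZMod q) / (d : ℂ)‖ ≤ ((d : ℝ))⁻¹ := by
      intro d hd
      have hd0 : (0 : ℝ) < d := by exact_mod_cast (Finset.mem_Icc.mp hd).1
      rw [norm_div, Complex.norm_natCast]
      calc ‖χ (d : ZMod q)‖ / (d : ℝ) ≤ 1 / d := div_le_div_of_nonneg_right (χ.norm_le_one _) hd0.le
        _ = ((d : ℝ))⁻¹ := one_div _
    refine (sum_le_sum e).trans ?_
    rw [show Icc 1 q = Ioc 0 q from rfl]
    exact sum_Ioc_inv_le q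
  have htail : 2 * (q : ℝ) / ((q : ℝ) + 1) ≤ 2 := by
    rw [div_le_iff₀ (by positivity)]; linarith
  have e : χ.LFunction 1 = (∑ d ∈ Icc 1 q, χ (d : ZMod q) / (d : ℂ)) -
      ((∑ d ∈ Icc 1 q, χ (d : ZMod q) / (d : ℂ)) - χ.LFunction 1) := by ring
  rw [e]
  refine (norm_sub_le _ _).trans ?_
  linarith

/-- `log y ≤ y/20 + 2` for `y > 0` (`log(y/20) ≤ y/20 − 1`, `log 20 < 3`). [folklore] -/
private theorem log_le_div_twenty_add_two {y : ℝ} (hy : 0 < y) : Real.log y ≤ y / 20 + 2 := by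
  have h1 := Real.log_le_sub_one_of_pos (show 0 < y / 20 by positivity)
  rw [Real.log_div hy.ne' (by norm_num)] at h1
  have h20 : Real.log 20 ≤ 3 := by
    have : Real.log 20 ≤ Real.log (Real.exp 3) := by
      refine Real.log_le_log (by norm_num) ?_
      have h := Real.exp_one_gt_d9
      have h3 : Real.exp 3 = Real.exp 1 * Real.exp 1 * Real.exp 1 := by
        rw [← Real.exp_add, ← Real.exp_add]; norm_num
      rw [h3]; norm_num at h; nlinarith [Real.exp_pos 1, mul_pos (Real.exp_pos 1) (Real.exp_pos 1)]
    rwa [Real.log_exp] at this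
  linarith

/-- **`‖L'(σ, χ)‖ ≤ 0.55 log²q` on `[1 − 1.6/log q, 1]`** for every non-principal `χ` mod `q` with
`log q ≥ 100` (the partial-sum bound `9√q log q`, `N = ⌈9√q log q⌉`, `log N ≤ 0.6 log q`,
`N^{1.6/log q} ≤ e`). [cite: Pintz1976ElementaryIV, §4 (4.1) p. 426 ("by the arguments of Page")] -/
theorem norm_deriv_LFunction_le_near_one_large [NeZero q] (hχ : χ ≠ 1)
    (hq : 100 ≤ Real.log q) {σ : ℝ} (hσr : 1 - 1.6 / Real.log q ≤ σ) (hσ1 : σ ≤ 1) :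
    ‖deriv χ.LFunction σ‖ ≤ 0.55 * Real.log q ^ 2 := by
  set L : ℝ := Real.log q with hL
  have hq0 : (0 : ℝ) < q := by exact_mod_cast Nat.pos_of_ne_zero (NeZero.ne q)
  have hq3 : 3 ≤ q := by
    by_contra hlt
    have hq2 : (q : ℝ) ≤ 2 := by exact_mod_cast (show q ≤ 2 by omega)
    have : L ≤ Real.log 2 := Real.log_le_log hq0 hq2
    have := Real.log_two_lt_d9
    norm_num at this; linarith
  have hq1 : (1 : ℝ) ≤ q := by exact_mod_cast (show 1 ≤ q by omega)
  have hsqrt1 : 1 ≤ Real.sqrt q := by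
    rw [show (1 : ℝ) = Real.sqrt 1 by simp]; exact Real.sqrt_le_sqrt hq1
  set B : ℝ := 9 * Real.sqrt q * L with hB
  have hB1 : 1 ≤ B := by simp only [hB]; nlinarith
  have hB0 : 0 ≤ B := by linarith
  have hBS := norm_partialSum_le_nine χ hχ hq3
  have hr1 : 1.6 / L < 1 := by rw [div_lt_one (by linarith)]; linarith
  have hr0 : 0 < 1.6 / L := by positivity
  have hrle : 1.6 / L ≤ 0.016 := by rw [div_le_iff₀ (by linarith)]; linarith
  have h := norm_deriv_LFunction_le_near_one_of_partialSum_le χ hχ hB1 hBS hr1 hσr hσ1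
  set N : ℕ := ⌈B⌉₊ with hN
  have hN1 : (1 : ℝ) ≤ N := by exact_mod_cast Nat.ceil_pos.2 (by linarith : 0 < B)
  have hN0 : (0 : ℝ) < N := by linarith
  have hNB : (N : ℝ) ≤ B + 1 := (Nat.ceil_lt_add_one hB0).le
  -- `log N ≤ 0.6 L`
  have hlogq2 : Real.log (Real.sqrt q) = L / 2 := by
    rw [Real.log_sqrt hq0.le]
  have hlogL : Real.log L ≤ L / 20 + 2 := log_le_div_twenty_add_two (by linarith)
  have hlog16 : Real.log 16 ≤ 2.78 := by
    rw [show (16 : ℝ) = 2 ^ 4 by norm_num, Real.log_pow]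
    have := Real.log_two_lt_d9; norm_num at this ⊢; linarith
  have hℓ : Real.log N ≤ 0.6 * L := by
    have h10 : (N : ℝ) ≤ 16 * (Real.sqrt q * L) := by
      have : B + 1 ≤ 16 * (Real.sqrt q * L) := by simp only [hB]; nlinarith
      linarith
    have hpos : 0 < Real.sqrt q * L := by positivity
    calc Real.log N ≤ Real.log (16 * (Real.sqrt q * L)) := Real.log_le_log hN0 h10
      _ = Real.log 16 + (Real.log (Real.sqrt q) + Real.log L) := by
          rw [Real.log_mul (by norm_num) hpos.ne', Real.log_mul (by positivity) (by linarith)]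
      _ ≤ 2.78 + (L / 2 + (L / 20 + 2)) := by rw [hlogq2]; linarith
      _ ≤ 0.6 * L := by linarith
  have hℓ0 : 0 ≤ Real.log N := Real.log_nonneg hN1
  -- `N^r ≤ e`
  have hNr : (N : ℝ) ^ (1.6 / L) ≤ 2.7182818286 := by
    rw [Real.rpow_def_of_pos hN0]
    have hexp : Real.log N * (1.6 / L) ≤ 1 := by
      calc Real.log N * (1.6 / L) ≤ 0.6 * L * (1.6 / L) :=
            mul_le_mul_of_nonneg_right hℓ hr0.le
        _ = 0.96 := by field_simp; ring
        _ ≤ 1 := by norm_num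
    calc Real.exp (Real.log N * (1.6 / L)) ≤ Real.exp 1 := Real.exp_le_exp.mpr hexp
      _ ≤ 2.7182818286 := Real.exp_one_lt_d9.le
  -- the bracket `≤ 0.2 L²`
  have hc : 1 + Real.log 2 ≤ 1.6932 := by have := Real.log_two_lt_d9; norm_num at this ⊢; linarith
  have hc0 : 0 ≤ 1 + Real.log 2 := by
    have := Real.log_nonneg (show (1:ℝ) ≤ 2 by norm_num); linarith
  have h1r : 0.984 ≤ 1 - 1.6 / L := by linarith
  have hinv1 : ((1 + Real.log 2) + Real.log N) / (1 - 1.6 / L) ≤ (1.6932 + 0.6 * L) / 0.984 := by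
    calc ((1 + Real.log 2) + Real.log N) / (1 - 1.6 / L)
        ≤ ((1 + Real.log 2) + Real.log N) / 0.984 :=
          div_le_div_of_nonneg_left (by positivity) (by norm_num) h1r
      _ ≤ (1.6932 + 0.6 * L) / 0.984 := by gcongr
  have hinv2 : 1 / (1 - 1.6 / L) ^ 2 ≤ 1 / 0.984 ^ 2 :=
    one_div_le_one_div_of_le (by norm_num) (pow_le_pow_left₀ (by norm_num) h1r 2)
  have hbr : Real.log N ^ 2 / 2 + (1 + Real.log 2) * Real.log N + (1 + Real.log 2) +
      ((1 + Real.log 2) + Real.log N) / (1 - 1.6 / L) + 1 / (1 - 1.6 / L) ^ 2 ≤ 0.2 * L ^ 2 := by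
    have hsq : Real.log N ^ 2 ≤ (0.6 * L) ^ 2 := pow_le_pow_left₀ hℓ0 hℓ 2
    have hcl : (1 + Real.log 2) * Real.log N ≤ 1.6932 * (0.6 * L) :=
      mul_le_mul hc hℓ hℓ0 (by norm_num)
    norm_num at hinv1 hinv2 ⊢
    nlinarith
  have hbr0 : 0 ≤ Real.log N ^ 2 / 2 + (1 + Real.log 2) * Real.log N + (1 + Real.log 2) +
      ((1 + Real.log 2) + Real.log N) / (1 - 1.6 / L) + 1 / (1 - 1.6 / L) ^ 2 := by
    have : 0 < 1 - 1.6 / L := by linarith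
    positivity
  calc ‖deriv χ.LFunction σ‖ ≤ _ := h
    _ ≤ 2.7182818286 * (0.2 * L ^ 2) :=
        mul_le_mul hNr hbr hbr0 (by norm_num)
    _ ≤ 0.55 * L ^ 2 := by nlinarith

/-- **Page's step (4.1), for every real non-principal — indeed every non-principal — `χ` mod `q` with
`log q ≥ 100`: at a real zero `β` of `L(s, χ)`, `‖L(1, χ)‖ ≤ 0.7 (1 − β) log²q`** (mean value theorem
on `[β, 1]` when `1 − β ≤ 1.6/log q`; `‖L(1,χ)‖ ≤ log q + 3` otherwise).
[cite: Pintz1976ElementaryIV, §4 (4.1) p. 426] -/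
theorem norm_LFunction_one_le_of_realZero [NeZero q] (hχ : χ ≠ 1) (hq : 100 ≤ Real.log q)
    {β : ℝ} (hzero : χ.LFunction β = 0) :
    ‖χ.LFunction 1‖ ≤ 0.7 * (1 - β) * Real.log q ^ 2 := by
  set L : ℝ := Real.log q with hL
  have hβ1 : β < 1 := by
    by_contra hle
    push Not at hle
    exact DirichletCharacter.LFunction_ne_zero_of_one_le_re χ (Or.inl hχ) (s := β)
      (by simpa using hle) hzero
  rcases le_or_gt (1 - β) (1.6 / L) with hsmall | hlarge
  · have hM := norm_LFunction_one_sub_le_of_norm_deriv_le χ hχ hβ1.le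
      (M := 0.55 * L ^ 2) fun σ h1 h2 =>
        norm_deriv_LFunction_le_near_one_large χ hχ hq (by linarith) h2
    rw [hzero, sub_zero] at hM
    have h0 : 0 ≤ 1 - β := by linarith
    nlinarith
  · have h1 := norm_LFunction_one_le_log_add_three χ hχ
    have hL0 : 0 < L := by linarith
    have h2 : 1.6 < (1 - β) * L := by
      have := (div_lt_iff₀ hL0).mp hlarge
      linarith
    nlinarith

end Pintz1976Heilbronn

open Pintz1976Heilbronn RealChar in
/-- **Pintz 1976 (IV), Theorem 2 — PROVED.** `∃ D₀ ∀ χ_k ≠ χ₀ mod k` with a zero `s₀ = 1 − γ + it`,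
`γ < 0.05`, `∀` real non-principal `χ_D` mod `D > D₀` with `χ_kχ_D` non-principal and every real zero
`1 − δ` (`δ > 0`) of `L(s, χ_D)`: `δ > 1/(140 U^{6γ} log⁵U)`, `U = k|s₀|D`. From Theorem 1's
quantitative core (`L(1, χ_D) ≥ 0.0086/(V^{6γ} log³V)`) and Page's step (4.1) in the form
`L(1, χ_D) ≤ 0.7 δ log²D` (`log D ≥ 100`). Discharges the named fact `pintz1976Heilbronn_theorem2`.
[cite: Pintz1976ElementaryIV, Theorem 2 p. 423 (2.2); proof §4 (4.1) p. 426] -/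
theorem pintz1976Heilbronn_theorem2_holds : pintz1976Heilbronn_theorem2 := by
  obtain ⟨V₀, hV₀⟩ := eventually_thresholds
  refine ⟨2 * V₀ + 10 + ⌈Real.exp 100⌉₊, ?_⟩
  intro k _ χk hχk γ t hγ hz D _ χD hD hχD hquad hprod δ hδ hzD
  have hD' : 2 * V₀ + 10 < D := by omega
  obtain ⟨hγ0, hV3, hVU, hUq, hL60, hkey⟩ :=
    theorem1_core χD χk hV₀ hχk hγ hz hD' hχD hquad hprod
  set U : ℝ := (k : ℝ) * ‖(1 - γ + t * Complex.I : ℂ)‖ * D with hUdef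
  set V : ℕ := ⌊U⌋₊ with hVdef
  set LV : ℝ := Real.log V with hLVdef
  set LU : ℝ := Real.log U with hLUdef
  set LD : ℝ := Real.log D with hLDdef
  have hV0 : (0 : ℝ) < V := by linarith
  have hU0 : 0 < U := by linarith
  have hLV0 : 0 < LV := by linarith
  have hLVU : LV ≤ LU := Real.log_le_log hV0 hVU
  have hLU60 : 60 ≤ LU := hL60.trans hLVU
  -- `log D ≥ 100` and `log D ≤ log U + 0.053`
  have hD0 : (0 : ℝ) < D := by exact_mod_cast (show 0 < D by omega)
  have hLD : 100 ≤ LD := by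
    have h1 : (⌈Real.exp 100⌉₊ : ℝ) ≤ D := by exact_mod_cast (show ⌈Real.exp 100⌉₊ ≤ D by omega)
    have h2 : Real.exp 100 ≤ D := (Nat.le_ceil _).trans h1
    have := Real.log_le_log (Real.exp_pos 100) h2
    rwa [Real.log_exp] at this
  have hLDU : LD ≤ LU + 0.053 := by
    have h1 : Real.log (0.95 * D) ≤ LU := Real.log_le_log (by positivity) hUq
    rw [Real.log_mul (by norm_num) hD0.ne'] at h1
    have h2 : 1 - (0.95 : ℝ)⁻¹ ≤ Real.log 0.95 := Real.one_sub_inv_le_log_of_pos (by norm_num)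
    norm_num at h2
    linarith
  have hLD2 : LD ^ 2 ≤ 1.002 * LU ^ 2 := by nlinarith
  -- Page: `L(1) ≤ 0.7 δ log²D`
  have hpage := norm_LFunction_one_le_of_realZero χD hχD hLD hzD
  have hδ' : (1 : ℝ) - (1 - δ) = δ := by ring
  rw [hδ'] at hpage
  have hL₁le : (χD.LFunction 1).re ≤ 0.7014 * δ * LU ^ 2 := by
    refine (Complex.re_le_norm _).trans (hpage.trans ?_)
    nlinarith
  -- Theorem 1 core: `L(1) ≥ 0.0086/(V^{6γ} log³V) ≥ 0.0086/(U^{6γ} log³U)`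
  set A : ℝ := U ^ (6 * γ) * LU ^ 3 with hA
  have hPU : (V : ℝ) ^ (6 * γ) ≤ U ^ (6 * γ) := Real.rpow_le_rpow hV0.le hVU (by linarith)
  have hP0 : 0 < (V : ℝ) ^ (6 * γ) := by positivity
  have hA0 : 0 < A := by positivity
  have hAV : (V : ℝ) ^ (6 * γ) * LV ^ 3 ≤ A := by
    simp only [hA]; gcongr
  have hkeyU : 0.0086 / A ≤ (χD.LFunction 1).re :=
    (div_le_div_of_nonneg_left (by norm_num) (by positivity) hAV).trans hkey
  have h1 : 0.0086 ≤ 0.7014 * δ * LU ^ 2 * A := by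
    have := (div_le_iff₀ hA0).mp (hkeyU.trans hL₁le)
    linarith
  have e : 140 * U ^ (6 * γ) * LU ^ 5 = 140 * (A * LU ^ 2) := by simp only [hA]; ring
  rw [e, div_lt_iff₀ (by positivity)]
  nlinarith

end Literature.NumberTheory.LFunctions

end
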